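import Literature.Computability.Complexity.UmansFPGenEval
import Literature.Computability.Complexity.CodeFPListKit
import Literature.Computability.Complexity.MurrayWilliams2018UmansBridge
import HarnessLib

/-!
# Umans' generator, machine level XV: the generator is polynomial time

Literature / circuit complexity — derandomization. `CodeFP` certificates for the programs of
`UmansFPGenSearch.lean` and `UmansFPGenEval.lean`, assembled into **`genTopC`**: Umans' generator
(JCSS 67 (2003), Thm. 6: "`G` can be computed in `n^{O(1)}` time given access to the truth table")
in Murray–Williams' interface `(Y, 1ˢ, seed) ↦ G(Y, seed)|ₛ` is a polynomial-time string function.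
All searches are exhaustive over sets of size `≤ cap = N^{O(1)}` (`N` the input length), every
fold has an unconditional polynomial size bound (entries are `W`-bit bitmasks, lists have the
modulus' length), so the certificates are unconditional.

Everything is proved; no named fact.

## References

* C. Umans, *Pseudo-random generators for all hardnesses*, JCSS 67 (2003), Thm. 6 [Umans2003].
* S. Arora, B. Barak, *Computational Complexity*, CUP 2009, §1.3 (polynomial-time string functions
  compose) [AroraBarak2009].
-/

noncomputable section

namespace Literature.Computability.Complexity

open Polynomial Literature.InformationTheory.Coding
open Literature.InformationTheory.Coding.GF2X CodeFP

namespace UmansFP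

/-! ### Size helpers -/

/-- A list of `W`-bit-bounded numbers has a short code. [folklore] -/
theorem length_rawE_natE_le_of_lt' {l : List ℕ} {W n : ℕ} (hl : l.length ≤ n) (h : ∀ x ∈ l, x < 2 ^ W) :
    (rawE natE l).length ≤ n * (2 * W + 2) :=
  (length_rawE_natE_le_of_lt h).trans (Nat.mul_le_mul_right _ hl)

/-- The code of a pair dominates both components. [folklore] -/
theorem length_pairE_ge {α β : Type} (ea : α → List Bool) (eb : β → List Bool) (a : α) (b : β) :
    (ea a).length ≤ (pairE ea eb (a, b)).length ∧ (eb b).length ≤ (pairE ea eb (a, b)).length := by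
  simp only [pairE_apply, length_boolPair]; omega

/-- `List.all` only depends on the predicate on members. [folklore] -/
theorem all_congr_mem {α : Type*} {l : List α} {p q : α → Bool} (h : ∀ x ∈ l, p x = q x) : l.all p = l.all q := by
  induction l with
  | nil => rfl
  | cons a l ih =>
    rw [List.all_cons, List.all_cons, h a List.mem_cons_self, ih fun x hx => h x (List.mem_cons_of_mem a hx)]

/-! ### `addHeadConstL`, `reduceModL`, `dividesL` -/

/-- **`addHeadConstL` on codes**: `(1ᵂ, acc, a) ↦ addHeadConstL W acc a`. [folklore] -/
theorem addHeadConstLC : CodeFP (pairE unE (pairE (rawE natE) natE)) (rawE natE) (fun t => addHeadConstL t.1 t.2.1 t.2.2) := by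
  have hW : CodeFP (pairE unE (pairE (rawE natE) natE)) unE (fun t => t.1) := fst _ _
  have hacc : CodeFP (pairE unE (pairE (rawE natE) natE)) (rawE natE) (fun t => t.2.1) := (snd _ _).fst'
  have ha : CodeFP (pairE unE (pairE (rawE natE) natE)) natE (fun t => t.2.2) := (snd _ _).snd'
  have hx : CodeFP (pairE unE (pairE (rawE natE) natE)) natE (fun t => xorW t.1 (t.2.1.headD 0) t.2.2) :=
    xorFP.comp (hW.pair (((rawHeadD natE natE_zero).comp hacc).pair ha))
  have hcons : CodeFP (pairE unE (pairE (rawE natE) natE)) (rawE natE) (fun t => xorW t.1 (t.2.1.headD 0) t.2.2 :: t.2.1.tail) :=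
    (rawCons natE).comp (hx.pair ((rawTail natE).comp hacc))
  exact (((rawIsEmpty natE).comp hacc).ite (const _ ([] : List ℕ)) hcons).congr fun t => by
    obtain ⟨W, acc, a⟩ := t
    cases acc with
    | nil => rfl
    | cons x xs => rfl

/-- The shape of the Horner accumulator: length `≤ |gc|`, entries below `2ᵂ`. [folklore] -/
theorem reduceModL_fold_shape (c : ℕ × ℕ × ℕ) (gc : List ℕ) : ∀ (l : List ℕ) (acc : List ℕ),
    acc.length ≤ gc.length → (∀ x ∈ acc, x < 2 ^ c.1) →
    (l.foldl (fun acc a => addHeadConstL c.1 (lmulz c gc acc) a) acc).length ≤ gc.length ∧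
      ∀ x ∈ l.foldl (fun acc a => addHeadConstL c.1 (lmulz c gc acc) a) acc, x < 2 ^ c.1
  | [], acc, h1, h2 => ⟨h1, h2⟩
  | a :: l, acc, h1, h2 => by
    rw [List.foldl_cons]
    have hz1 : (lmulz c gc acc).length ≤ gc.length := by
      rw [lmulz, List.length_zipWith, lsmul, List.length_map]; exact min_le_right _ _
    have hz2 : ∀ x ∈ lmulz c gc acc, x < 2 ^ c.1 := fun x hx => by
      rw [lmulz] at hx
      obtain ⟨p, q, -, -, rfl⟩ := exists_of_mem_zipWith hx
      exact xorW_lt _ _ _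
    refine reduceModL_fold_shape c gc l _ ?_ ?_
    · cases hl : lmulz c gc acc with
      | nil => rw [addHeadConstL]; exact Nat.zero_le _
      | cons x xs => rw [addHeadConstL, List.length_cons, ← List.length_cons (a := x), ← hl]; exact hz1
    · intro x hx
      cases hl : lmulz c gc acc with
      | nil => rw [hl, addHeadConstL] at hx; exact absurd hx List.not_mem_nil
      | cons y ys =>
        rw [hl, addHeadConstL, List.mem_cons] at hx
        rcases hx with rfl | hx
        · exact xorW_lt _ _ _
        · exact hz2 x (by rw [hl]; exact List.mem_cons_of_mem y hx)

/-- **`reduceModL` on codes**: `(c, gc, pl) ↦ reduceModL c gc pl`. [cite: KnuthTAOCP2, §4.6.1] -/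
theorem reduceModLC : CodeFP l3E (rawE natE) (fun t => reduceModL t.1 t.2.1 t.2.2) := by
  -- context `σ = (c, gc)`, items = `pl.reverse`
  let σE : (ℕ × ℕ × ℕ) × List ℕ → List Bool := pairE kctxE (rawE natE)
  have hstep : CodeFP (pairE σE (pairE natE (rawE natE))) (rawE natE) (fun t => addHeadConstL t.1.1.1 (lmulz t.1.1 t.1.2 t.2.2) t.2.1) := by
    have hc : CodeFP (pairE σE (pairE natE (rawE natE))) kctxE (fun t => t.1.1) := (fst _ _).fst'
    have hgc : CodeFP (pairE σE (pairE natE (rawE natE))) (rawE natE) (fun t => t.1.2) := (fst _ _).snd'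
    have hacc : CodeFP (pairE σE (pairE natE (rawE natE))) (rawE natE) (fun t => t.2.2) := (snd _ _).snd'
    have ha : CodeFP (pairE σE (pairE natE (rawE natE))) natE (fun t => t.2.1) := (snd _ _).fst'
    have hz : CodeFP (pairE σE (pairE natE (rawE natE))) (rawE natE) (fun t => lmulz t.1.1 t.1.2 t.2.2) :=
      (lmulzFP.comp (hc.pair (hgc.pair hacc)) :)
    exact (addHeadConstLC.comp (hc.fst'.pair (hz.pair ha)) :)
  have hinit : CodeFP σE (rawE natE) (fun s => List.replicate s.2.length 0) :=
    ((replicateOf natE).comp ((const _ 0).pair ((ulength natE).comp (snd _ _)))).congr fun _ => rfl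
  have h := foldl (eσ := σE) (eα := natE) (eβ := rawE natE)
    (step := fun (s : (ℕ × ℕ × ℕ) × List ℕ) (a : ℕ) (acc : List ℕ) => addHeadConstL s.1.1 (lmulz s.1 s.2 acc) a)
    (init := fun s => List.replicate s.2.length 0) hstep hinit (X * X)
    (fun s l₁ l₂ => by
      obtain ⟨c, gc⟩ := s
      obtain ⟨h1, h2⟩ := reduceModL_fold_shape c gc l₁ (List.replicate gc.length 0) (by rw [List.length_replicate])
        (fun x hx => by rw [List.eq_of_mem_replicate hx]; exact Nat.two_pow_pos _)
      set N := (pairE σE (rawE natE) ((c, gc), l₁ ++ l₂)).length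
      have hN1 : (rawE natE gc).length ≤ N := by
        show _ ≤ (boolPair (boolPair (kctxE c) (rawE natE gc)) (rawE natE (l₁ ++ l₂))).length
        rw [length_boolPair, length_boolPair]; omega
      have hN2 : 2 * c.1 + 2 ≤ N := by
        obtain ⟨W, f, P⟩ := c
        show _ ≤ (boolPair (boolPair (kctxE (W, f, P)) (rawE natE gc)) (rawE natE (l₁ ++ l₂))).length
        simp only [pairE_apply, length_boolPair, length_unE]; omega
      simp only [eval_mul, eval_X]
      exact (length_rawE_natE_le_of_lt' h1 h2).trans (Nat.mul_le_mul ((length_le_length_rawE _ _).trans hN1) hN2))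
  exact (h.comp (((fst _ _).pair (snd _ _).fst').pair ((rawReverse natE).comp (snd _ _).snd'))).congr fun _ => rfl

/-- **`dividesL` on codes.** [cite: LidlNiederreiter1996, §3.2] -/
theorem dividesLC : CodeFP l3E bitE (fun t => dividesL t.1 t.2.1 t.2.2) := by
  have hz : CodeFP (pairE unitE natE) bitE (fun t => t.2 == 0) := (natEq.comp ((snd _ _).pair (const _ 0))).congr fun t => by
    rw [Bool.eq_iff_iff, decide_eq_true_eq, beq_iff_eq]
  exact ((all hz).comp ((const _ ()).pair reduceModLC)).congr fun _ => rfl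

/-! ### All lists over an alphabet -/

/-- The shape of the enumeration frontier: at most `max 1 cap` lists of length `≤` rounds so far,
letters from the alphabet. [folklore] -/
theorem vecsOverL_fold_shape (cap : ℕ) (alpha : List ℕ) : ∀ (l : List Unit) (acc : List (List ℕ)) (k : ℕ),
    acc.length ≤ max 1 cap → (∀ v ∈ acc, v.length ≤ k ∧ ∀ x ∈ v, x ∈ alpha) →
    (l.foldl (fun acc _ => (acc.flatMap fun v => alpha.map fun a => v ++ [a]).take cap) acc).length ≤ max 1 cap ∧
      ∀ v ∈ l.foldl (fun acc _ => (acc.flatMap fun v => alpha.map fun a => v ++ [a]).take cap) acc, v.length ≤ k + l.length ∧ ∀ x ∈ v, x ∈ alpha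
  | [], acc, k, h1, h2 => ⟨h1, fun v hv => ⟨(h2 v hv).1.trans (Nat.le_add_right _ _), (h2 v hv).2⟩⟩
  | _ :: l, acc, k, h1, h2 => by
    rw [List.foldl_cons]
    obtain ⟨r1, r2⟩ := vecsOverL_fold_shape cap alpha l ((acc.flatMap fun v => alpha.map fun a => v ++ [a]).take cap) (k + 1)
      (by rw [List.length_take]; omega) (fun v hv => by
      have hv' := List.mem_of_mem_take hv
      rw [List.mem_flatMap] at hv'
      obtain ⟨v₀, hv₀, hv⟩ := hv'
      obtain ⟨a, ha, rfl⟩ := List.mem_map.1 hv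
      refine ⟨by rw [List.length_append, List.length_singleton]; exact Nat.succ_le_succ (h2 v₀ hv₀).1, fun x hx => ?_⟩
      rw [List.mem_append, List.mem_singleton] at hx
      rcases hx with hx | rfl
      · exact (h2 v₀ hv₀).2 x hx
      · exact ha)
    exact ⟨r1, fun v hv => ⟨(r2 v hv).1.trans (by rw [List.length_cons]; omega), (r2 v hv).2⟩⟩

/-- **`vecsOverL` on codes**: `(1^{cap}, alpha, 1ᵈ) ↦ vecsOverL cap alpha d`. [folklore] -/
theorem vecsOverLC : CodeFP (pairE unE (pairE (rawE natE) unE)) (rawE (rawE natE)) (fun t => vecsOverL t.1 t.2.1 t.2.2) := by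
  -- context `σ = (cap, alpha)`
  let σE : ℕ × List ℕ → List Bool := pairE unE (rawE natE)
  -- the inner map `v ↦ alpha.map (v ++ [·])`, context `(σ, v)`
  have happ : CodeFP (pairE (pairE σE (rawE natE)) natE) (rawE natE) (fun t => t.1.2 ++ [t.2]) :=
    (rawAppend natE).comp ((fst _ _).snd'.pair ((rawSingleton natE).comp (snd _ _)))
  have hinner : CodeFP (pairE σE (rawE natE)) (rawE (rawE natE)) (fun q => q.1.2.map fun a => q.2 ++ [a]) :=
    ((map happ).comp ((CodeFP.id _).pair (fst _ _).snd')).congr fun _ => rfl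
  have hstep : CodeFP (pairE σE (pairE unitE (rawE (rawE natE)))) (rawE (rawE natE))
      (fun t => (t.2.2.flatMap fun v => t.1.2.map fun a => v ++ [a]).take t.1.1) := by
    have hm : CodeFP (pairE σE (pairE unitE (rawE (rawE natE)))) (rawE (rawE (rawE natE)))
        (fun t => t.2.2.map fun v => t.1.2.map fun a => v ++ [a]) := ((map hinner).comp ((fst _ _).pair (snd _ _).snd')).congr fun _ => rfl
    exact ((rawTakeUn (rawE natE)).comp ((fst _ _).fst'.pair ((flatten (rawE natE)).comp hm))).congr fun t => by
      simp [List.flatMap_def]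
  have hinit : CodeFP σE (rawE (rawE natE)) (fun _ => [([] : List ℕ)]) := const _ _
  have h := foldl (eσ := σE) (eα := unitE) (eβ := rawE (rawE natE))
    (step := fun (s : ℕ × List ℕ) (_ : Unit) (acc : List (List ℕ)) => (acc.flatMap fun v => s.2.map fun a => v ++ [a]).take s.1)
    (init := fun _ => [([] : List ℕ)]) hstep hinit ((X + 1) * ((X * X + X) * 4 + 2))
    (fun s l₁ l₂ => by
      obtain ⟨cap, alpha⟩ := s
      obtain ⟨h1, h2⟩ := vecsOverL_fold_shape cap alpha l₁ [[]] 0 (by simp) (by simp)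
      set N := (pairE σE (rawE unitE) ((cap, alpha), l₁ ++ l₂)).length
      have hNcap : cap ≤ N := by
        show _ ≤ (boolPair (boolPair (unE cap) (rawE natE alpha)) (rawE unitE (l₁ ++ l₂))).length
        rw [length_boolPair, length_boolPair, length_unE]; omega
      have hNal : (rawE natE alpha).length ≤ N := by
        show _ ≤ (boolPair (boolPair (unE cap) (rawE natE alpha)) (rawE unitE (l₁ ++ l₂))).length
        rw [length_boolPair, length_boolPair]; omega
      have hNl : l₁.length ≤ N := by
        show _ ≤ (boolPair (boolPair (unE cap) (rawE natE alpha)) (rawE unitE (l₁ ++ l₂))).length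
        rw [length_boolPair]
        have := length_le_length_rawE unitE (l₁ ++ l₂); rw [List.length_append] at this; omega
      -- each frontier list has code length `≤ N (N + ...)`: entries are alphabet letters
      have hv : ∀ v ∈ l₁.foldl (fun acc _ => (acc.flatMap fun v => alpha.map fun a => v ++ [a]).take cap) [[]],
          (rawE natE v).length ≤ N * (2 * N + 2) := by
        intro v hv'
        obtain ⟨hvlen, hvmem⟩ := h2 v hv'
        rw [zero_add] at hvlen
        have hx : ∀ x ∈ v, (natE x).length ≤ N := fun x hx => by
          have := (length_item_le_length_rawE natE (hvmem x hx)).trans hNal; omega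
        calc (rawE natE v).length ≤ v.length * (2 * N + 2) := length_rawE_le_of_forall hx
          _ ≤ N * (2 * N + 2) := Nat.mul_le_mul_right _ (hvlen.trans hNl)
      simp only [eval_mul, eval_add, eval_X, eval_one, eval_ofNat]
      calc (rawE (rawE natE) _).length ≤ _ * (2 * (N * (2 * N + 2)) + 2) := length_rawE_le_of_forall hv
        _ ≤ (N + 1) * ((N * N + N) * 4 + 2) := by
          apply Nat.mul_le_mul (h1.trans (by omega)) (le_of_eq (by ring)))
  exact (h.comp (((fst _ _).pair (snd _ _).fst').pair (replicateUnit.comp (snd _ _).snd'))).congr fun _ => rfl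

/-! ### The irreducibility test and the modulus search -/

/-- Code of `(c, 1^{cap}, 1^q, pc)`. [folklore] -/
abbrev irE : (ℕ × ℕ × ℕ) × ℕ × ℕ × List ℕ → List Bool := pairE kctxE (pairE unE (pairE unE (rawE natE)))

/-- **`irredTestL` on codes**: `(c, 1^{cap}, 1^q, pc) ↦ irredTestL c cap q pc`. [cite: LidlNiederreiter1996, §3.2] -/
theorem irredTestLC : CodeFP irE bitE (fun t => irredTestL t.1 t.2.1 t.2.2.1 t.2.2.2) := by
  have hc : CodeFP irE kctxE (fun t => t.1) := fst _ _
  have hcap : CodeFP irE unE (fun t => t.2.1) := (snd _ _).fst'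
  have hq : CodeFP irE unE (fun t => t.2.2.1) := (snd _ _).snd'.fst'
  have hpc : CodeFP irE (rawE natE) (fun t => t.2.2.2) := (snd _ _).snd'.snd'
  -- the inner test on a candidate divisor `gc`, context `(t, e)` irrelevant: `(t, gc) ↦ ! dividesL c gc (pc ++ [1])`
  have hp1 : CodeFP irE (rawE natE) (fun t => t.2.2.2 ++ [1]) := (rawAppend natE).comp (hpc.pair (const _ [1]))
  have hdiv : CodeFP (pairE (pairE irE natE) (rawE natE)) bitE (fun u => !(dividesL u.1.1.1 u.2 (u.1.1.2.2.2 ++ [1]))) :=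
    (dividesLC.comp ((fst _ _).fst'.fst'.pair ((snd _ _).pair (hp1.comp (fst _ _).fst')))).not
  -- the candidates of degree `e`: `vecsOverL cap (range q) e` with `e` unary (`e ≤ |pc|`)
  have he : CodeFP (pairE irE natE) unE (fun u => min u.2 u.1.2.2.2.length) := unOfNatMin.comp (((ulength natE).comp (fst _ _).snd'.snd'.snd').pair (snd _ _))
  have hvecs : CodeFP (pairE irE natE) (rawE (rawE natE)) (fun u => vecsOverL u.1.2.1 (List.range u.1.2.2.1) (min u.2 u.1.2.2.2.length)) :=
    vecsOverLC.comp ((fst _ _).snd'.fst'.pair ((urange.comp (fst _ _).snd'.snd'.fst').pair he))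
  have hall : CodeFP (pairE irE natE) bitE (fun u => (vecsOverL u.1.2.1 (List.range u.1.2.2.1) (min u.2 u.1.2.2.2.length)).all
      fun gc => !(dividesL u.1.1 gc (u.1.2.2.2 ++ [1]))) := ((all hdiv).comp ((CodeFP.id _).pair hvecs)).congr fun _ => rfl
  have hor : CodeFP (pairE irE natE) bitE (fun u => (u.2 == 0) || (vecsOverL u.1.2.1 (List.range u.1.2.2.1) (min u.2 u.1.2.2.2.length)).all
      fun gc => !(dividesL u.1.1 gc (u.1.2.2.2 ++ [1]))) := by
    have hz : CodeFP (pairE irE natE) bitE (fun u => u.2 == 0) := (natEq.comp ((snd _ _).pair (const _ 0))).congr fun u => by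
      rw [Bool.eq_iff_iff, decide_eq_true_eq, beq_iff_eq]
    exact hz.or hall
  -- the range of degrees `e < |pc|/2 + 1`, as `range (min (|pc|/2+1) (|pc|+1))`
  have hdeg : CodeFP irE (rawE natE) (fun t => List.range (min (t.2.2.2.length / 2 + 1) (t.2.2.2.length + 1))) :=
    rangeOf.comp ((unSucc.comp ((ulength natE).comp hpc)).pair (natAdd.comp ((natDiv.comp (((natLength natE).comp hpc).pair (const _ 2))).pair (const _ 1))))
  refine (((all hor).comp ((CodeFP.id _).pair hdeg))).congr fun t => ?_
  obtain ⟨c, cap, q, pc⟩ := t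
  show (List.range (min (pc.length / 2 + 1) (pc.length + 1))).all _ = irredTestL c cap q pc
  rw [irredTestL, min_eq_left (by omega)]
  refine all_congr_mem fun e he => ?_
  have hele : e ≤ pc.length := by have := List.mem_range.1 he; omega
  simp only [id]
  rw [min_eq_left hele]

/-- **`findIrredL` on codes**: `(c, 1^{cap}, 1^q, 1ᵈ, Hl) ↦ findIrredL c cap q d Hl`. [cite: Umans2003, §3, Lemma 7] -/
theorem findIrredLC : CodeFP (pairE kctxE (pairE unE (pairE unE (pairE unE (rawE natE))))) (rawE natE)
    (fun t => findIrredL t.1 t.2.1 t.2.2.1 t.2.2.2.1 t.2.2.2.2) := by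
  let E := pairE kctxE (pairE unE (pairE unE (pairE unE (rawE natE))))
  have hc : CodeFP E kctxE (fun t => t.1) := fst _ _
  have hcap : CodeFP E unE (fun t => t.2.1) := (snd _ _).fst'
  have hq : CodeFP E unE (fun t => t.2.2.1) := (snd _ _).snd'.fst'
  have hd : CodeFP E unE (fun t => t.2.2.2.1) := (snd _ _).snd'.snd'.fst'
  have hHl : CodeFP E (rawE natE) (fun t => t.2.2.2.2) := (snd _ _).snd'.snd'.snd'
  have hvecs : CodeFP E (rawE (rawE natE)) (fun t => vecsOverL t.2.1 t.2.2.2.2 t.2.2.2.1) := vecsOverLC.comp (hcap.pair (hHl.pair hd))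
  have htest : CodeFP (pairE E (rawE natE)) bitE (fun u => irredTestL u.1.1 u.1.2.1 u.1.2.2.1 u.2) :=
    irredTestLC.comp ((fst _ _).fst'.pair ((fst _ _).snd'.fst'.pair ((fst _ _).snd'.snd'.fst'.pair (snd _ _))))
  have hfind := (rawFind? htest).comp ((CodeFP.id _).pair hvecs)
  exact (((rawHeadD (rawE natE) (d := ([] : List ℕ)) rfl).comp ((optToList (rawE natE)).comp hfind))).congr fun t => by
    obtain ⟨c, cap, q, d, Hl⟩ := t
    show ((vecsOverL cap Hl d).find? fun x => irredTestL c cap q x).toList.headD [] = findIrredL c cap q d Hl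
    rw [findIrredL]
    cases (vecsOverL cap Hl d).find? (fun x => irredTestL c cap q x) <;> rfl

/-! ### The primitive element search -/

/-- **`isZeroL` on codes.** [folklore] -/
theorem isZeroLC : CodeFP (rawE natE) bitE isZeroL :=
  ((beq (rawE_injective natE_injective)).comp ((CodeFP.id _).pair ((replicateOf natE).comp ((const _ 0).pair (ulength natE))))).congr fun _ => rfl

/-- **`isOneL` on codes.** [folklore] -/
theorem isOneLC : CodeFP (rawE natE) bitE isOneL :=
  ((beq (rawE_injective natE_injective)).comp ((CodeFP.id _).pair (loneFP.comp (ulength natE)))).congr fun _ => rfl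

/-- The unary `P - 1` from the unary `P`. [folklore] -/
theorem unPred : CodeFP unE unE (fun P => P - 1) :=
  (unOfNatMin.comp ((CodeFP.id _).pair (natSub.comp (natOfUn.pair (const _ 1))))).congr fun P => by
    show min (P - 1) P = P - 1; omega

/-- **`powNeOneL` on codes**: `(c, pc, u, 1ᴾ) ↦ powNeOneL c pc u P` (a fold of `P - 1` rounds whose
state is an `lmul` output). [cite: LidlNiederreiter1996, Thm. 2.8] -/
theorem powNeOneLC : CodeFP l4uE bitE (fun t => powNeOneL t.1 t.2.1 t.2.2.1 t.2.2.2) := by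
  let stE : List ℕ × Bool → List Bool := pairE (rawE natE) bitE
  have hstep : CodeFP (pairE l3E (pairE unitE stE)) stE (fun t => (lmul t.1.1 t.1.2.1 t.2.2.1 t.1.2.2, t.2.2.2 && !(isOneL t.2.2.1))) := by
    have hc : CodeFP (pairE l3E (pairE unitE stE)) kctxE (fun t => t.1.1) := (fst _ _).fst'
    have hpc : CodeFP (pairE l3E (pairE unitE stE)) (rawE natE) (fun t => t.1.2.1) := (fst _ _).snd'.fst'
    have hu : CodeFP (pairE l3E (pairE unitE stE)) (rawE natE) (fun t => t.1.2.2) := (fst _ _).snd'.snd'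
    have hst : CodeFP (pairE l3E (pairE unitE stE)) (rawE natE) (fun t => t.2.2.1) := (snd _ _).snd'.fst'
    have hok : CodeFP (pairE l3E (pairE unitE stE)) bitE (fun t => t.2.2.2) := (snd _ _).snd'.snd'
    have hm : CodeFP (pairE l3E (pairE unitE stE)) (rawE natE) (fun t => lmul t.1.1 t.1.2.1 t.2.2.1 t.1.2.2) :=
      (lmulFP.comp (hc.pair (hpc.pair (hst.pair hu))) :)
    exact hm.pair (hok.and ((isOneLC.comp hst).not))
  have hinit : CodeFP l3E stE (fun s => (s.2.2, true)) := (snd _ _).snd'.pair (const _ true)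
  have h := foldl (eσ := l3E) (eα := unitE) (eβ := stE)
    (step := fun (s : (ℕ × ℕ × ℕ) × List ℕ × List ℕ) (_ : Unit) (st : List ℕ × Bool) => (lmul s.1 s.2.1 st.1 s.2.2, st.2 && !(isOneL st.1)))
    (init := fun s => (s.2.2, true)) hstep hinit ((X * X + X) * 2 + 8)
    (fun s l₁ l₂ => by
      obtain ⟨c, pc, u⟩ := s
      set N := (pairE l3E (rawE unitE) ((c, pc, u), l₁ ++ l₂)).length
      obtain ⟨hW, hR, hU⟩ := le_length_l3E c pc u
      have hN : (l3E (c, pc, u)).length ≤ N := (length_pairE_ge l3E (rawE unitE) (c, pc, u) (l₁ ++ l₂)).1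
      -- the state's list: `u` (no rounds) or an `lmul` output
      have hshape : ∀ (l : List Unit) (st : List ℕ × Bool), (st.1 = u ∨ ((st.1.length ≤ pc.length) ∧ ∀ x ∈ st.1, x < 2 ^ c.1)) →
          let st' := l.foldl (fun st _ => (lmul c pc st.1 u, st.2 && !(isOneL st.1))) st
          st'.1 = u ∨ ((st'.1.length ≤ pc.length) ∧ ∀ x ∈ st'.1, x < 2 ^ c.1) := by
        intro l
        induction l with
        | nil => intro st h; exact h
        | cons _ l ih => intro st _; rw [List.foldl_cons]; exact ih _ (Or.inr (lmul_bound c pc st.1 u))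
      have hlist : (rawE natE (l₁.foldl (fun st _ => (lmul c pc st.1 u, st.2 && !(isOneL st.1))) (u, true)).1).length ≤ N * N + N := by
        rcases hshape l₁ (u, true) (Or.inl rfl) with h | ⟨h1, h2⟩
        · rw [h]; nlinarith [hU.trans hN]
        · calc _ ≤ pc.length * (2 * c.1 + 2) := length_rawE_natE_le_of_lt' h1 h2
            _ ≤ N * N + N := by nlinarith [(length_le_length_rawE natE pc).trans (hR.trans hN), hW.trans hN]
      simp only [eval_add, eval_mul, eval_X, eval_ofNat]
      show (boolPair (rawE natE _) (bitE _)).length ≤ _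
      rw [length_boolPair]
      have hb : ∀ b : Bool, (bitE b).length = 1 := fun b => by cases b <;> rfl
      rw [hb]; omega)
  exact ((snd _ _).comp (h.comp (((fst _ _).pair ((snd _ _).fst'.pair (snd _ _).snd'.fst')).pair
    (replicateUnit.comp (unPred.comp (snd _ _).snd'.snd'))))).congr fun _ => rfl

/-- Code of `(c, 1^{cap}, 1^q, pc, 1ᴾ)`. [folklore] -/
abbrev prE : (ℕ × ℕ × ℕ) × ℕ × ℕ × List ℕ × ℕ → List Bool := pairE kctxE (pairE unE (pairE unE (pairE (rawE natE) unE)))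

/-- **`findPrimL` on codes**: `(c, 1^{cap}, 1^q, pc, 1ᴾ) ↦ findPrimL c cap q pc P`. [cite: Umans2003, §4.1] -/
theorem findPrimLC : CodeFP prE (rawE natE) (fun t => findPrimL t.1 t.2.1 t.2.2.1 t.2.2.2.1 t.2.2.2.2) := by
  have hc : CodeFP prE kctxE (fun t => t.1) := fst _ _
  have hcap : CodeFP prE unE (fun t => t.2.1) := (snd _ _).fst'
  have hq : CodeFP prE unE (fun t => t.2.2.1) := (snd _ _).snd'.fst'
  have hpc : CodeFP prE (rawE natE) (fun t => t.2.2.2.1) := (snd _ _).snd'.snd'.fst'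
  have hP : CodeFP prE unE (fun t => t.2.2.2.2) := (snd _ _).snd'.snd'.snd'
  have hvecs : CodeFP prE (rawE (rawE natE)) (fun t => vecsOverL t.2.1 (List.range t.2.2.1) t.2.2.2.1.length) :=
    vecsOverLC.comp (hcap.pair ((urange.comp hq).pair ((ulength natE).comp hpc)))
  have htest : CodeFP (pairE prE (rawE natE)) bitE (fun u => !(isZeroL u.2) && powNeOneL u.1.1 u.1.2.2.2.1 u.2 u.1.2.2.2.2) :=
    (isZeroLC.comp (snd _ _)).not.and (powNeOneLC.comp ((fst _ _).fst'.pair ((hpc.comp (fst _ _)).pair ((snd _ _).pair (hP.comp (fst _ _))))))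
  have hfind := (rawFind? htest).comp ((CodeFP.id _).pair hvecs)
  exact (((rawHeadD (rawE natE) (d := ([] : List ℕ)) rfl).comp ((optToList (rawE natE)).comp hfind))).congr fun t => by
    obtain ⟨c, cap, q, pc, P⟩ := t
    show ((vecsOverL cap (List.range q) pc.length).find? fun u => !(isZeroL u) && powNeOneL c pc u P).toList.headD [] = findPrimL c cap q pc P
    rw [findPrimL]
    cases (vecsOverL cap (List.range q) pc.length).find? (fun u => !(isZeroL u) && powNeOneL c pc u P) <;> rfl

/-! ### The normal element search -/

/-- The Frobenius rows as an iteration (for the machine). [folklore] -/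
theorem frobRowsL_eq_fold (c : ℕ × ℕ × ℕ) (pc u : List ℕ) (logq : ℕ) :
    frobRowsL c pc u logq = ((List.replicate pc.length ()).foldl (fun st _ => (lsqIter c pc st.1 logq, st.2 ++ [st.1])) (u, ([] : List (List ℕ)))).2 := by
  have inv : ∀ j : ℕ, (List.replicate j ()).foldl (fun st _ => (lsqIter c pc st.1 logq, st.2 ++ [st.1])) (u, ([] : List (List ℕ))) =
      (lsqIter c pc u (logq * j), (List.range j).map fun i => lsqIter c pc u (logq * i)) := by
    intro j
    induction j with
    | zero => simp [lsqIter]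
    | succ j ih =>
      rw [List.replicate_succ', List.foldl_append, List.foldl_cons, List.foldl_nil, ih, List.range_succ, List.map_append, List.map_singleton]
      simp only [Prod.mk.injEq, and_true]
      rw [lsqIter, lsqIter, ← List.foldl_append, ← List.replicate_add, Nat.mul_succ]; rfl
  rw [inv, frobRowsL]

/-- **`frobRowsL` on codes**: `(c, pc, u, 1^{logq}) ↦ frobRowsL c pc u logq`. [cite: Umans2003, §4.2, Def. 9] -/
theorem frobRowsLC : CodeFP l4uE (rawE (rawE natE)) (fun t => frobRowsL t.1 t.2.1 t.2.2.1 t.2.2.2) := by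
  let stE : List ℕ × List (List ℕ) → List Bool := pairE (rawE natE) (rawE (rawE natE))
  have hstep : CodeFP (pairE l4uE (pairE unitE stE)) stE (fun t => (lsqIter t.1.1 t.1.2.1 t.2.2.1 t.1.2.2.2, t.2.2.2 ++ [t.2.2.1])) := by
    have hc : CodeFP (pairE l4uE (pairE unitE stE)) kctxE (fun t => t.1.1) := (fst _ _).fst'
    have hpc : CodeFP (pairE l4uE (pairE unitE stE)) (rawE natE) (fun t => t.1.2.1) := (fst _ _).snd'.fst'
    have hk : CodeFP (pairE l4uE (pairE unitE stE)) unE (fun t => t.1.2.2.2) := (fst _ _).snd'.snd'.snd'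
    have hst : CodeFP (pairE l4uE (pairE unitE stE)) (rawE natE) (fun t => t.2.2.1) := (snd _ _).snd'.fst'
    have hrows : CodeFP (pairE l4uE (pairE unitE stE)) (rawE (rawE natE)) (fun t => t.2.2.2) := (snd _ _).snd'.snd'
    have hsq : CodeFP (pairE l4uE (pairE unitE stE)) (rawE natE) (fun t => lsqIter t.1.1 t.1.2.1 t.2.2.1 t.1.2.2.2) :=
      (lsqIterFP.comp (hc.pair (hpc.pair (hst.pair hk))) :)
    exact hsq.pair ((rawAppend (rawE natE)).comp (hrows.pair ((rawSingleton (rawE natE)).comp hst)))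
  have hinit : CodeFP l4uE stE (fun s => (s.2.2.1, ([] : List (List ℕ)))) := (snd _ _).snd'.fst'.pair (const _ _)
  have h := foldl (eσ := l4uE) (eα := unitE) (eβ := stE)
    (step := fun (s : (ℕ × ℕ × ℕ) × List ℕ × List ℕ × ℕ) (_ : Unit) (st : List ℕ × List (List ℕ)) => (lsqIter s.1 s.2.1 st.1 s.2.2.2, st.2 ++ [st.1]))
    (init := fun s => (s.2.2.1, ([] : List (List ℕ)))) hstep hinit ((X + 2) * (X * X + X + 2) * 3)
    (fun s l₁ l₂ => by
      obtain ⟨c, pc, u, k⟩ := s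
      set N := (pairE l4uE (rawE unitE) ((c, pc, u, k), l₁ ++ l₂)).length
      have hN0 : (l4uE (c, pc, u, k)).length ≤ N := (length_pairE_ge l4uE (rawE unitE) _ _).1
      have hW : 2 * c.1 + 2 ≤ N := by
        obtain ⟨W, f, P⟩ := c
        refine le_trans ?_ hN0
        simp only [pairE_apply, length_boolPair, length_unE]; omega
      have hR : (rawE natE pc).length ≤ N := by
        refine le_trans ?_ hN0; simp only [pairE_apply, length_boolPair]; omega
      have hU : (rawE natE u).length ≤ N := by
        refine le_trans ?_ hN0; simp only [pairE_apply, length_boolPair]; omega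
      have hl : l₁.length ≤ N := by
        have := length_le_length_rawE unitE (l₁ ++ l₂)
        have h2 := (length_pairE_ge l4uE (rawE unitE) (c, pc, u, k) (l₁ ++ l₂)).2
        rw [List.length_append] at this; omega
      -- every listed element and the current one: `u` or an `lsqIter` output of bounded shape
      have hshape : ∀ (l : List Unit) (st : List ℕ × List (List ℕ)),
          (st.1 = u ∨ (st.1.length ≤ pc.length ∧ ∀ x ∈ st.1, x < 2 ^ c.1)) →
          (∀ r ∈ st.2, r = u ∨ (r.length ≤ pc.length ∧ ∀ x ∈ r, x < 2 ^ c.1)) → st.2.length + l.length = st.2.length + l.length →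
          let st' := l.foldl (fun st _ => (lsqIter c pc st.1 k, st.2 ++ [st.1])) st
          (st'.1 = u ∨ (st'.1.length ≤ pc.length ∧ ∀ x ∈ st'.1, x < 2 ^ c.1)) ∧
            (∀ r ∈ st'.2, r = u ∨ (r.length ≤ pc.length ∧ ∀ x ∈ r, x < 2 ^ c.1)) ∧ st'.2.length = st.2.length + l.length := by
        intro l
        induction l with
        | nil => intro st h1 h2 _; exact ⟨h1, h2, rfl⟩
        | cons _ l ih =>
          intro st h1 h2 _
          rw [List.foldl_cons]
          obtain ⟨r1, r2, r3⟩ := ih (lsqIter c pc st.1 k, st.2 ++ [st.1]) (by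
              have := foldl_lsqIter_bound c pc st.1 (List.replicate k ()) st.1 (Or.inl rfl)
              rcases this with h | h
              · rw [lsqIter, h]; exact h1
              · exact Or.inr h)
            (fun r hr => by
              rw [List.mem_append, List.mem_singleton] at hr
              rcases hr with hr | rfl
              · exact h2 r hr
              · exact h1) rfl
          exact ⟨r1, r2, by rw [r3, List.length_append, List.length_singleton, List.length_cons]; omega⟩
      obtain ⟨s1, s2, s3⟩ := hshape l₁ (u, []) (Or.inl rfl) (fun r hr => absurd hr List.not_mem_nil) rfl
      have hitem : ∀ r : List ℕ, (r = u ∨ (r.length ≤ pc.length ∧ ∀ x ∈ r, x < 2 ^ c.1)) → (rawE natE r).length ≤ N * N + N := by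
        rintro r (rfl | ⟨h1, h2⟩)
        · nlinarith
        · calc _ ≤ pc.length * (2 * c.1 + 2) := length_rawE_natE_le_of_lt' h1 h2
            _ ≤ N * N + N := by nlinarith [(length_le_length_rawE natE pc).trans hR]
      simp only [eval_add, eval_mul, eval_X, eval_ofNat]
      show (boolPair (rawE natE _) (rawE (rawE natE) _)).length ≤ _
      rw [length_boolPair]
      have hA := hitem _ s1
      have hB : (rawE (rawE natE) (l₁.foldl (fun st _ => (lsqIter c pc st.1 k, st.2 ++ [st.1])) (u, [])).2).length ≤ N * (2 * (N * N + N) + 2) := by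
        refine (length_rawE_le_of_forall fun r hr => hitem r (s2 r hr)).trans (Nat.mul_le_mul_right _ ?_)
        rw [s3, List.length_nil, zero_add]; exact hl
      nlinarith)
  have hm := (snd _ _).comp (h.comp ((CodeFP.id _).pair (replicateUnit.comp ((ulength natE).comp (snd _ _).fst'))))
  refine hm.congr fun t => ?_
  obtain ⟨c, pc, u, k⟩ := t
  rw [frobRowsL_eq_fold]
  rfl

/-- **`isNormalL` on codes**: `(c, pc, u, 1^{logq}) ↦ isNormalL c pc u logq`. [cite: LidlNiederreiter1996, §2.3] -/
theorem isNormalLC : CodeFP l4uE bitE (fun t => isNormalL t.1 t.2.1 t.2.2.1 t.2.2.2) := by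
  have hk := kerVecKC.comp ((fst _ _).pair (((ulength natE).comp (snd _ _).fst').pair frobRowsLC))
  have hn := ((optIsSome (rawE natE)).comp hk).not
  refine hn.congr fun t => ?_
  obtain ⟨c, pc, u, k⟩ := t
  show (!(kerVecK c pc.length (frobRowsL c pc u k)).isSome) = isNormalL c pc u k
  rw [isNormalL]
  cases kerVecK c pc.length (frobRowsL c pc u k) <;> rfl

/-- **`findNormalL` on codes**: `(c, 1^{cap}, 1^q, pc, 1^{logq}) ↦ findNormalL c cap q pc logq`. [cite: Umans2003, §4.2, Def. 9] -/
theorem findNormalLC : CodeFP prE (rawE natE) (fun t => findNormalL t.1 t.2.1 t.2.2.1 t.2.2.2.1 t.2.2.2.2) := by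
  have hc : CodeFP prE kctxE (fun t => t.1) := fst _ _
  have hcap : CodeFP prE unE (fun t => t.2.1) := (snd _ _).fst'
  have hq : CodeFP prE unE (fun t => t.2.2.1) := (snd _ _).snd'.fst'
  have hpc : CodeFP prE (rawE natE) (fun t => t.2.2.2.1) := (snd _ _).snd'.snd'.fst'
  have hP : CodeFP prE unE (fun t => t.2.2.2.2) := (snd _ _).snd'.snd'.snd'
  have hvecs : CodeFP prE (rawE (rawE natE)) (fun t => vecsOverL t.2.1 (List.range t.2.2.1) t.2.2.2.1.length) :=
    vecsOverLC.comp (hcap.pair ((urange.comp hq).pair ((ulength natE).comp hpc)))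
  have hA : CodeFP (pairE prE (rawE natE)) kctxE (fun u => u.1.1) := (fst _ _).fst'
  have hB : CodeFP (pairE prE (rawE natE)) (rawE natE) (fun u => u.1.2.2.2.1) := hpc.comp (fst _ _)
  have hC : CodeFP (pairE prE (rawE natE)) (rawE natE) (fun u => u.2) := snd _ _
  have hD : CodeFP (pairE prE (rawE natE)) unE (fun u => u.1.2.2.2.2) := hP.comp (fst _ _)
  have htest := isNormalLC.comp (hA.pair (hB.pair (hC.pair hD)))
  have hfind := (rawFind? htest).comp ((CodeFP.id _).pair hvecs)
  exact (((rawHeadD (rawE natE) (d := ([] : List ℕ)) rfl).comp ((optToList (rawE natE)).comp hfind))).congr fun t => by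
    obtain ⟨c, cap, q, pc, P⟩ := t
    show ((vecsOverL cap (List.range q) pc.length).find? fun u => isNormalL c pc u P).toList.headD [] = findNormalL c cap q pc P
    rw [findNormalL]
    cases (vecsOverL cap (List.range q) pc.length).find? (fun u => isNormalL c pc u P) <;> rfl

/-! ### The Lagrange extension and the augmented encoding -/

/-- Code of `(c, Hl, a, t)`. [folklore] -/
abbrev lgE : (ℕ × ℕ × ℕ) × List ℕ × ℕ × ℕ → List Bool := pairE kctxE (pairE (rawE natE) (pairE natE natE))

/-- A `cmul`-fold accumulator is `init` or below `2ᵂ`. [folklore] -/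
theorem foldl_cmul_shape (c : ℕ × ℕ × ℕ) {ι : Type} (f : ι → ℕ) : ∀ (l : List ι) (acc : ℕ),
    l.foldl (fun acc i => cmul c acc (f i)) acc = acc ∨ l.foldl (fun acc i => cmul c acc (f i)) acc < 2 ^ c.1
  | [], acc => Or.inl rfl
  | i :: l, acc => by
    rw [List.foldl_cons]
    rcases foldl_cmul_shape c f l (cmul c acc (f i)) with h | h
    · rw [h]; exact Or.inr (mulMod_lt _ _ _ _ _ _)
    · exact Or.inr h

/-- **`lagEvalL` on codes**: `(c, Hl, a, t) ↦ lagEvalL c Hl a t`. [cite: Umans2003, §4.1, eq. (2)] -/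
theorem lagEvalLC : CodeFP lgE natE (fun t => lagEvalL t.1 t.2.1 t.2.2.1 t.2.2.2) := by
  have hc : CodeFP lgE kctxE (fun t => t.1) := fst _ _
  have hHl : CodeFP lgE (rawE natE) (fun t => t.2.1) := (snd _ _).fst'
  have ha : CodeFP lgE natE (fun t => t.2.2.1) := (snd _ _).snd'.fst'
  have ht : CodeFP lgE natE (fun t => t.2.2.2) := (snd _ _).snd'.snd'
  -- the filtered node list
  have hne : CodeFP (pairE lgE natE) bitE (fun u => u.2 != u.1.2.2.1) :=
    (natEq.comp ((snd _ _).pair (ha.comp (fst _ _)))).not.congr fun u => by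
      rw [Bool.eq_iff_iff]; simp [bne_iff_ne, ne_eq]
  have hfl : CodeFP lgE (rawE natE) (fun t => t.2.1.filter fun a' => a' != t.2.2.1) := ((filter hne).comp ((CodeFP.id _).pair hHl)).congr fun _ => rfl
  -- the step `acc, a' ↦ cmul c acc (cmul c (xorW c.1 t a') (cinv c (xorW c.1 a a')))`
  have hstep : CodeFP (pairE lgE (pairE natE natE)) natE
      (fun u => cmul u.1.1 u.2.2 (cmul u.1.1 (xorW u.1.1.1 u.1.2.2.2 u.2.1) (cinv u.1.1 (xorW u.1.1.1 u.1.2.2.1 u.2.1)))) := by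
    have hc' : CodeFP (pairE lgE (pairE natE natE)) kctxE (fun u => u.1.1) := (fst _ _).fst'
    have hW : CodeFP (pairE lgE (pairE natE natE)) unE (fun u => u.1.1.1) := hc'.fst'
    have ha' : CodeFP (pairE lgE (pairE natE natE)) natE (fun u => u.1.2.2.1) := ha.comp (fst _ _)
    have ht' : CodeFP (pairE lgE (pairE natE natE)) natE (fun u => u.1.2.2.2) := ht.comp (fst _ _)
    have hx : CodeFP (pairE lgE (pairE natE natE)) natE (fun u => u.2.1) := (snd _ _).fst'
    have hacc : CodeFP (pairE lgE (pairE natE natE)) natE (fun u => u.2.2) := (snd _ _).snd'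
    have h1 : CodeFP (pairE lgE (pairE natE natE)) natE (fun u => xorW u.1.1.1 u.1.2.2.2 u.2.1) := xorFP.comp (hW.pair (ht'.pair hx))
    have h2 : CodeFP (pairE lgE (pairE natE natE)) natE (fun u => xorW u.1.1.1 u.1.2.2.1 u.2.1) := xorFP.comp (hW.pair (ha'.pair hx))
    have h3 : CodeFP (pairE lgE (pairE natE natE)) natE (fun u => cinv u.1.1 (xorW u.1.1.1 u.1.2.2.1 u.2.1)) := (kinvFP.comp (hc'.pair h2)).congr fun _ => rfl
    have h4 : CodeFP (pairE lgE (pairE natE natE)) natE (fun u => cmul u.1.1 (xorW u.1.1.1 u.1.2.2.2 u.2.1) (cinv u.1.1 (xorW u.1.1.1 u.1.2.2.1 u.2.1))) :=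
      (kmulFP.comp (hc'.pair (h1.pair h3))).congr fun _ => rfl
    exact (kmulFP.comp (hc'.pair (hacc.pair h4))).congr fun _ => rfl
  have h := foldl (eσ := lgE) (eα := natE) (eβ := natE)
    (step := fun (s : (ℕ × ℕ × ℕ) × List ℕ × ℕ × ℕ) (a' : ℕ) (acc : ℕ) => cmul s.1 acc (cmul s.1 (xorW s.1.1 s.2.2.2 a') (cinv s.1 (xorW s.1.1 s.2.2.1 a'))))
    (init := fun _ => 1) hstep (const _ 1) (X + 2)
    (fun s l₁ l₂ => by
      obtain ⟨c, Hl, a, t⟩ := s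
      set N := (pairE lgE (rawE natE) ((c, Hl, a, t), l₁ ++ l₂)).length
      have hW : c.1 + 1 ≤ N := by
        obtain ⟨W, f, P⟩ := c
        refine le_trans ?_ (length_pairE_ge lgE (rawE natE) _ _).1
        simp only [pairE_apply, length_boolPair, length_unE]; omega
      simp only [eval_add, eval_X, eval_ofNat]
      rcases foldl_cmul_shape c (fun a' => cmul c (xorW c.1 t a') (cinv c (xorW c.1 a a'))) l₁ 1 with h | h
      · rw [h]; exact (length_natE_le 1).trans (by omega)
      · have := Nat.size_le.2 h; rw [length_natE]; omega)
  exact (h.comp ((CodeFP.id _).pair hfl)).congr fun _ => rfl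

/-- Code of `(c, Hl, pos, u)`. [folklore] -/
abbrev ltE : (ℕ × ℕ × ℕ) × List ℕ × List ℕ × List ℕ → List Bool := pairE kctxE (pairE (rawE natE) (pairE (rawE natE) (rawE natE)))

/-- **`ldeTermL` on codes**: `(c, Hl, pos, u) ↦ ldeTermL c Hl pos u`. [cite: Umans2003, §4.1, eq. (2)] -/
theorem ldeTermLC : CodeFP ltE natE (fun t => ldeTermL t.1 t.2.1 t.2.2.1 t.2.2.2) := by
  have hstep : CodeFP (pairE ltE (pairE natE natE)) natE
      (fun u => cmul u.1.1 u.2.2 (lagEvalL u.1.1 u.1.2.1 (u.1.2.2.1.getD u.2.1 0) (u.1.2.2.2.getD u.2.1 0))) := by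
    have hc : CodeFP (pairE ltE (pairE natE natE)) kctxE (fun u => u.1.1) := (fst _ _).fst'
    have hHl : CodeFP (pairE ltE (pairE natE natE)) (rawE natE) (fun u => u.1.2.1) := (fst _ _).snd'.fst'
    have hpos : CodeFP (pairE ltE (pairE natE natE)) (rawE natE) (fun u => u.1.2.2.1) := (fst _ _).snd'.snd'.fst'
    have hu : CodeFP (pairE ltE (pairE natE natE)) (rawE natE) (fun u => u.1.2.2.2) := (fst _ _).snd'.snd'.snd'
    have hj : CodeFP (pairE ltE (pairE natE natE)) natE (fun u => u.2.1) := (snd _ _).fst'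
    have hacc : CodeFP (pairE ltE (pairE natE natE)) natE (fun u => u.2.2) := (snd _ _).snd'
    have hp : CodeFP (pairE ltE (pairE natE natE)) natE (fun u => u.1.2.2.1.getD u.2.1 0) := (rawGetD natE natE_zero).comp (hpos.pair hj)
    have hq : CodeFP (pairE ltE (pairE natE natE)) natE (fun u => u.1.2.2.2.getD u.2.1 0) := (rawGetD natE natE_zero).comp (hu.pair hj)
    have hl := lagEvalLC.comp (hc.pair (hHl.pair (hp.pair hq)))
    exact (kmulFP.comp (hc.pair (hacc.pair hl))).congr fun _ => rfl
  have h := foldl (eσ := ltE) (eα := natE) (eβ := natE)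
    (step := fun (s : (ℕ × ℕ × ℕ) × List ℕ × List ℕ × List ℕ) (j : ℕ) (acc : ℕ) => cmul s.1 acc (lagEvalL s.1 s.2.1 (s.2.2.1.getD j 0) (s.2.2.2.getD j 0)))
    (init := fun _ => 1) hstep (const _ 1) (X + 2)
    (fun s l₁ l₂ => by
      obtain ⟨c, Hl, pos, u⟩ := s
      set N := (pairE ltE (rawE natE) ((c, Hl, pos, u), l₁ ++ l₂)).length
      have hW : c.1 + 1 ≤ N := by
        obtain ⟨W, f, P⟩ := c
        refine le_trans ?_ (length_pairE_ge ltE (rawE natE) _ _).1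
        simp only [pairE_apply, length_boolPair, length_unE]; omega
      simp only [eval_add, eval_X, eval_ofNat]
      rcases foldl_cmul_shape c (fun j => lagEvalL c Hl (pos.getD j 0) (u.getD j 0)) l₁ 1 with h | h
      · rw [h]; exact (length_natE_le 1).trans (by omega)
      · have := Nat.size_le.2 h; rw [length_natE]; omega)
  exact (h.comp ((CodeFP.id _).pair (urange.comp ((ulength natE).comp (snd _ _).snd'.fst')))).congr fun _ => rfl

/-- Code of `(c, Hl, posL, xs, u)`. [folklore] -/
abbrev leE : (ℕ × ℕ × ℕ) × List ℕ × List (List ℕ) × List Bool × List ℕ → List Bool :=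
  pairE kctxE (pairE (rawE natE) (pairE (rawE (rawE natE)) (pairE strE (rawE natE))))

/-- **`ldeEvalL` on codes**: `(c, Hl, posL, xs, u) ↦ ldeEvalL c Hl posL xs u`. [cite: Umans2003, §4.1, eq. (2), Thm. 8] -/
theorem ldeEvalLC : CodeFP leE natE (fun t => ldeEvalL t.1 t.2.1 t.2.2.1 t.2.2.2.1 t.2.2.2.2) := by
  have hstep : CodeFP (pairE leE (pairE natE natE)) natE
      (fun u => if u.1.2.2.2.1.getD u.2.1 false then xorW u.1.1.1 u.2.2 (ldeTermL u.1.1 u.1.2.1 (u.1.2.2.1.getD u.2.1 []) u.1.2.2.2.2) else u.2.2) := by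
    have hc : CodeFP (pairE leE (pairE natE natE)) kctxE (fun u => u.1.1) := (fst _ _).fst'
    have hHl : CodeFP (pairE leE (pairE natE natE)) (rawE natE) (fun u => u.1.2.1) := (fst _ _).snd'.fst'
    have hposL : CodeFP (pairE leE (pairE natE natE)) (rawE (rawE natE)) (fun u => u.1.2.2.1) := (fst _ _).snd'.snd'.fst'
    have hxs : CodeFP (pairE leE (pairE natE natE)) strE (fun u => u.1.2.2.2.1) := (fst _ _).snd'.snd'.snd'.fst'
    have hu : CodeFP (pairE leE (pairE natE natE)) (rawE natE) (fun u => u.1.2.2.2.2) := (fst _ _).snd'.snd'.snd'.snd'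
    have hk : CodeFP (pairE leE (pairE natE natE)) natE (fun u => u.2.1) := (snd _ _).fst'
    have hacc : CodeFP (pairE leE (pairE natE natE)) natE (fun u => u.2.2) := (snd _ _).snd'
    have hbit : CodeFP (pairE leE (pairE natE natE)) bitE (fun u => u.1.2.2.2.1.getD u.2.1 false) := strGetDNat.comp (hxs.pair hk)
    have hpos : CodeFP (pairE leE (pairE natE natE)) (rawE natE) (fun u => u.1.2.2.1.getD u.2.1 []) := (rawGetD (rawE natE) (d := ([] : List ℕ)) rfl).comp (hposL.pair hk)
    have hterm := ldeTermLC.comp (hc.pair (hHl.pair (hpos.pair hu)))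
    have hx : CodeFP (pairE leE (pairE natE natE)) natE (fun u => xorW u.1.1.1 u.2.2 (ldeTermL u.1.1 u.1.2.1 (u.1.2.2.1.getD u.2.1 []) u.1.2.2.2.2)) :=
      (xorFP.comp (hc.fst'.pair (hacc.pair hterm))).congr fun _ => rfl
    exact hbit.ite hx hacc
  have hshape : ∀ (c : ℕ × ℕ × ℕ) (g : ℕ → ℕ) (b : ℕ → Bool) (l : List ℕ) (acc : ℕ),
      l.foldl (fun acc k => if b k then xorW c.1 acc (g k) else acc) acc = acc ∨ l.foldl (fun acc k => if b k then xorW c.1 acc (g k) else acc) acc < 2 ^ c.1 := by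
    intro c g b l
    induction l with
    | nil => intro acc; exact Or.inl rfl
    | cons k l ih =>
      intro acc
      rw [List.foldl_cons]
      rcases ih (if b k then xorW c.1 acc (g k) else acc) with h | h
      · rw [h]
        split_ifs
        · exact Or.inr (xorW_lt _ _ _)
        · exact Or.inl rfl
      · exact Or.inr h
  have h := foldl (eσ := leE) (eα := natE) (eβ := natE)
    (step := fun (s : (ℕ × ℕ × ℕ) × List ℕ × List (List ℕ) × List Bool × List ℕ) (k : ℕ) (acc : ℕ) =>
      if s.2.2.2.1.getD k false then xorW s.1.1 acc (ldeTermL s.1 s.2.1 (s.2.2.1.getD k []) s.2.2.2.2) else acc)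
    (init := fun _ => 0) hstep (const _ 0) (X + 2)
    (fun s l₁ l₂ => by
      obtain ⟨c, Hl, posL, xs, u⟩ := s
      set N := (pairE leE (rawE natE) ((c, Hl, posL, xs, u), l₁ ++ l₂)).length
      have hW : c.1 + 1 ≤ N := by
        obtain ⟨W, f, P⟩ := c
        refine le_trans ?_ (length_pairE_ge leE (rawE natE) _ _).1
        simp only [pairE_apply, length_boolPair, length_unE]; omega
      simp only [eval_add, eval_X, eval_ofNat]
      rcases hshape c (fun k => ldeTermL c Hl (posL.getD k []) u) (fun k => xs.getD k false) l₁ 0 with h | h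
      · rw [h]; exact Nat.zero_le _
      · have := Nat.size_le.2 h; rw [length_natE]; omega)
  exact (h.comp ((CodeFP.id _).pair (urange.comp ((ulength (rawE natE)).comp (snd _ _).snd'.fst')))).congr fun _ => rfl

/-- Code of `(c, pc, 1^{logq}, Hl, posL, xs, βu, u)`. [folklore] -/
abbrev auE : (ℕ × ℕ × ℕ) × List ℕ × ℕ × List ℕ × List (List ℕ) × List Bool × List ℕ × List ℕ → List Bool :=
  pairE kctxE (pairE (rawE natE) (pairE unE (pairE (rawE natE) (pairE (rawE (rawE natE)) (pairE strE (pairE (rawE natE) (rawE natE)))))))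

/-- The unary product `a · b` of unary numerals. [folklore] -/
theorem unMulUn : CodeFP (pairE unE unE) unE (fun p => p.1 * p.2) :=
  (unSum.comp ((replicateOf unE).comp ((fst _ _).pair (snd _ _)))).congr fun p => by
    simp [List.sum_replicate, mul_comm]

/-- The shape of an `ladd`-fold accumulator: length `≤ |init|`, entries below `2ᵂ` (given so initially). [folklore] -/
theorem foldl_ladd_shape (W : ℕ) {ι : Type} (f : ι → List ℕ) : ∀ (l : List ι) (acc : List ℕ) (n : ℕ),
    acc.length ≤ n → (∀ x ∈ acc, x < 2 ^ W) →
    (l.foldl (fun acc i => ladd W acc (f i)) acc).length ≤ n ∧ ∀ x ∈ l.foldl (fun acc i => ladd W acc (f i)) acc, x < 2 ^ W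
  | [], acc, n, h1, h2 => ⟨h1, h2⟩
  | i :: l, acc, n, h1, h2 => by
    rw [List.foldl_cons]
    refine foldl_ladd_shape W f l _ n ?_ ?_
    · rw [ladd, List.length_zipWith]; exact (min_le_left _ _).trans h1
    · intro x hx
      rw [ladd] at hx
      obtain ⟨p, q, -, -, rfl⟩ := exists_of_mem_zipWith hx
      exact xorW_lt _ _ _

/-- The augmented encoding's output shape. [folklore] -/
theorem augEvalL_shape (c : ℕ × ℕ × ℕ) (pc : List ℕ) (logq : ℕ) (Hl : List ℕ) (posL : List (List ℕ)) (xs : List Bool) (βu u : List ℕ) :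
    (augEvalL c pc logq Hl posL xs βu u).length ≤ pc.length ∧ ∀ x ∈ augEvalL c pc logq Hl posL xs βu u, x < 2 ^ c.1 := by
  rw [augEvalL]
  exact foldl_ladd_shape c.1 _ _ _ _ (by rw [List.length_replicate]) (fun x hx => by rw [List.eq_of_mem_replicate hx]; exact Nat.two_pow_pos _)

/-- **`augEvalL` on codes**: `(c, pc, 1^{logq}, Hl, posL, xs, βu, u) ↦ augEvalL c pc logq Hl posL xs βu u`.
[cite: Umans2003, §4.2, Def. 9] -/
theorem augEvalLC : CodeFP auE (rawE natE) (fun t => augEvalL t.1 t.2.1 t.2.2.1 t.2.2.2.1 t.2.2.2.2.1 t.2.2.2.2.2.1 t.2.2.2.2.2.2.1 t.2.2.2.2.2.2.2) := by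
  let E := pairE auE (pairE natE (rawE natE))
  have hc : CodeFP E kctxE (fun u => u.1.1) := (fst _ _).fst'
  have hpc : CodeFP E (rawE natE) (fun u => u.1.2.1) := (fst _ _).snd'.fst'
  have hlogq : CodeFP E unE (fun u => u.1.2.2.1) := (fst _ _).snd'.snd'.fst'
  have hHl : CodeFP E (rawE natE) (fun u => u.1.2.2.2.1) := (fst _ _).snd'.snd'.snd'.fst'
  have hposL : CodeFP E (rawE (rawE natE)) (fun u => u.1.2.2.2.2.1) := (fst _ _).snd'.snd'.snd'.snd'.fst'
  have hxs : CodeFP E strE (fun u => u.1.2.2.2.2.2.1) := (fst _ _).snd'.snd'.snd'.snd'.snd'.fst'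
  have hβ : CodeFP E (rawE natE) (fun u => u.1.2.2.2.2.2.2.1) := (fst _ _).snd'.snd'.snd'.snd'.snd'.snd'.fst'
  have hu : CodeFP E (rawE natE) (fun u => u.1.2.2.2.2.2.2.2) := (fst _ _).snd'.snd'.snd'.snd'.snd'.snd'.snd'
  have hj : CodeFP E natE (fun u => u.2.1) := (snd _ _).fst'
  have hacc : CodeFP E (rawE natE) (fun u => u.2.2) := (snd _ _).snd'
  -- unary `j` and `|pc| - j` (both `≤ |pc|`)
  have hd : CodeFP E unE (fun u => u.1.2.1.length) := (ulength natE).comp hpc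
  have hjU : CodeFP E unE (fun u => min u.2.1 u.1.2.1.length) := unOfNatMin.comp (hd.pair hj)
  have hdjU : CodeFP E unE (fun u => min (u.1.2.1.length - u.2.1) u.1.2.1.length) :=
    unOfNatMin.comp (hd.pair (natSub.comp (((natLength natE).comp hpc).pair hj)))
  have hk1 : CodeFP E unE (fun u => u.1.2.2.1 * min (u.1.2.1.length - u.2.1) u.1.2.1.length) := unMulUn.comp (hlogq.pair hdjU)
  have hk2 : CodeFP E unE (fun u => u.1.2.2.1 * min u.2.1 u.1.2.1.length) := unMulUn.comp (hlogq.pair hjU)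
  have hsq1 : CodeFP E (rawE natE) (fun u => lsqIter u.1.1 u.1.2.1 u.1.2.2.2.2.2.2.2 (u.1.2.2.1 * min (u.1.2.1.length - u.2.1) u.1.2.1.length)) :=
    (lsqIterFP.comp (hc.pair (hpc.pair (hu.pair hk1))) :)
  have hsq2 : CodeFP E (rawE natE) (fun u => lsqIter u.1.1 u.1.2.1 u.1.2.2.2.2.2.2.1 (u.1.2.2.1 * min u.2.1 u.1.2.1.length)) :=
    (lsqIterFP.comp (hc.pair (hpc.pair (hβ.pair hk2))) :)
  have hφ := ldeEvalLC.comp (hc.pair (hHl.pair (hposL.pair (hxs.pair hsq1))))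
  have hsm := lsmulFP.comp (hc.pair (hφ.pair hsq2))
  have hstep := laddFP.comp (hc.fst'.pair (hacc.pair hsm))
  have hinit : CodeFP auE (rawE natE) (fun s => List.replicate s.2.1.length 0) :=
    ((replicateOf natE).comp ((const _ 0).pair ((ulength natE).comp (snd _ _).fst'))).congr fun _ => rfl
  have h := foldl (eσ := auE) (eα := natE) (eβ := rawE natE)
    (step := fun (s : (ℕ × ℕ × ℕ) × List ℕ × ℕ × List ℕ × List (List ℕ) × List Bool × List ℕ × List ℕ) (j : ℕ) (acc : List ℕ) =>
      ladd s.1.1 acc (lsmul s.1 (ldeEvalL s.1 s.2.2.2.1 s.2.2.2.2.1 s.2.2.2.2.2.1 (lsqIter s.1 s.2.1 s.2.2.2.2.2.2.2 (s.2.2.1 * min (s.2.1.length - j) s.2.1.length)))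
        (lsqIter s.1 s.2.1 s.2.2.2.2.2.2.1 (s.2.2.1 * min j s.2.1.length))))
    (init := fun s => List.replicate s.2.1.length 0) (hstep.congr fun _ => rfl) hinit (X * X)
    (fun s l₁ l₂ => by
      obtain ⟨c, pc, logq, Hl, posL, xs, βu, u⟩ := s
      set N := (pairE auE (rawE natE) ((c, pc, logq, Hl, posL, xs, βu, u), l₁ ++ l₂)).length
      have hN0 := (length_pairE_ge auE (rawE natE) (c, pc, logq, Hl, posL, xs, βu, u) (l₁ ++ l₂)).1
      have hW : 2 * c.1 + 2 ≤ N := by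
        obtain ⟨W, f, P⟩ := c
        refine le_trans ?_ hN0
        simp only [pairE_apply, length_boolPair, length_unE]; omega
      have hR : pc.length ≤ N := by
        refine le_trans ((length_le_length_rawE natE pc).trans ?_) hN0
        simp only [pairE_apply, length_boolPair]; omega
      obtain ⟨h1, h2⟩ := foldl_ladd_shape c.1 (fun j => lsmul c (ldeEvalL c Hl posL xs (lsqIter c pc u (logq * min (pc.length - j) pc.length)))
        (lsqIter c pc βu (logq * min j pc.length))) l₁ (List.replicate pc.length 0) pc.length (by rw [List.length_replicate])
        (fun x hx => by rw [List.eq_of_mem_replicate hx]; exact Nat.two_pow_pos _)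
      simp only [eval_mul, eval_X]
      exact (length_rawE_natE_le_of_lt' h1 h2).trans (Nat.mul_le_mul hR hW))
  refine (h.comp ((CodeFP.id _).pair (urange.comp ((ulength natE).comp (snd _ _).fst')))).congr fun t => ?_
  obtain ⟨c, pc, logq, Hl, posL, xs, βu, u⟩ := t
  show (List.range pc.length).foldl _ (List.replicate pc.length 0) = augEvalL c pc logq Hl posL xs βu u
  rw [augEvalL]
  apply List.foldl_ext
  intro acc j hj
  have hjl : j < pc.length := List.mem_range.1 hj
  simp only [id]
  rw [min_eq_left hjl.le, min_eq_left (Nat.sub_le pc.length j)]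

/-! ### Positions, symbols, output bits, parsing -/

/-- **`positionsL` on codes**: `(c, pc, γu, 1ⁿ) ↦ positionsL c pc γu n`. [cite: Umans2003, §4.1] -/
theorem positionsLC : CodeFP l4uE (rawE (rawE natE)) (fun t => positionsL t.1 t.2.1 t.2.2.1 t.2.2.2) := by
  let stE : List ℕ × List (List ℕ) → List Bool := pairE (rawE natE) (rawE (rawE natE))
  have hstep : CodeFP (pairE l4uE (pairE unitE stE)) stE (fun t => (lmul t.1.1 t.1.2.1 t.2.2.1 t.1.2.2.1, t.2.2.2 ++ [t.2.2.1])) := by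
    have hc : CodeFP (pairE l4uE (pairE unitE stE)) kctxE (fun t => t.1.1) := (fst _ _).fst'
    have hpc : CodeFP (pairE l4uE (pairE unitE stE)) (rawE natE) (fun t => t.1.2.1) := (fst _ _).snd'.fst'
    have hγ : CodeFP (pairE l4uE (pairE unitE stE)) (rawE natE) (fun t => t.1.2.2.1) := (fst _ _).snd'.snd'.fst'
    have hst : CodeFP (pairE l4uE (pairE unitE stE)) (rawE natE) (fun t => t.2.2.1) := (snd _ _).snd'.fst'
    have hrows : CodeFP (pairE l4uE (pairE unitE stE)) (rawE (rawE natE)) (fun t => t.2.2.2) := (snd _ _).snd'.snd'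
    have hm : CodeFP (pairE l4uE (pairE unitE stE)) (rawE natE) (fun t => lmul t.1.1 t.1.2.1 t.2.2.1 t.1.2.2.1) :=
      (lmulFP.comp (hc.pair (hpc.pair (hst.pair hγ))) :)
    exact hm.pair ((rawAppend (rawE natE)).comp (hrows.pair ((rawSingleton (rawE natE)).comp hst)))
  have hinit : CodeFP l4uE stE (fun s => (lone s.2.1.length, ([] : List (List ℕ)))) := (loneFP.comp ((ulength natE).comp (snd _ _).fst')).pair (const _ _)
  have h := foldl (eσ := l4uE) (eα := unitE) (eβ := stE)
    (step := fun (s : (ℕ × ℕ × ℕ) × List ℕ × List ℕ × ℕ) (_ : Unit) (st : List ℕ × List (List ℕ)) => (lmul s.1 s.2.1 st.1 s.2.2.1, st.2 ++ [st.1]))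
    (init := fun s => (lone s.2.1.length, ([] : List (List ℕ)))) hstep hinit ((X * X + X) * (X + 3) * 3)
    (fun s l₁ l₂ => by
      obtain ⟨c, pc, γu, n⟩ := s
      set N := (pairE l4uE (rawE unitE) ((c, pc, γu, n), l₁ ++ l₂)).length
      have hN0 : (l4uE (c, pc, γu, n)).length ≤ N := (length_pairE_ge l4uE (rawE unitE) _ _).1
      have hW : 2 * c.1 + 4 ≤ N := by
        obtain ⟨W, f, P⟩ := c
        refine le_trans ?_ hN0; simp only [pairE_apply, length_boolPair, length_unE]; omega
      have hR : pc.length ≤ N := by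
        refine le_trans ((length_le_length_rawE natE pc).trans ?_) hN0; simp only [pairE_apply, length_boolPair]; omega
      have hl : l₁.length ≤ N := by
        have := length_le_length_rawE unitE (l₁ ++ l₂)
        have h2 := (length_pairE_ge l4uE (rawE unitE) (c, pc, γu, n) (l₁ ++ l₂)).2
        rw [List.length_append] at this; omega
      -- all lists in play have length `≤ |pc|` and entries `< 2^{c.1}` (`lone` has entries `≤ 1`)
      have hshape : ∀ (l : List Unit) (st : List ℕ × List (List ℕ)),
          (st.1.length ≤ pc.length ∧ ∀ x ∈ st.1, x < 2 ^ (c.1 + 1)) → (∀ r ∈ st.2, r.length ≤ pc.length ∧ ∀ x ∈ r, x < 2 ^ (c.1 + 1)) →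
          let st' := l.foldl (fun st _ => (lmul c pc st.1 γu, st.2 ++ [st.1])) st
          (st'.1.length ≤ pc.length ∧ ∀ x ∈ st'.1, x < 2 ^ (c.1 + 1)) ∧ (∀ r ∈ st'.2, r.length ≤ pc.length ∧ ∀ x ∈ r, x < 2 ^ (c.1 + 1)) ∧
            st'.2.length = st.2.length + l.length := by
        intro l
        induction l with
        | nil => intro st h1 h2; exact ⟨h1, h2, rfl⟩
        | cons _ l ih =>
          intro st h1 h2
          rw [List.foldl_cons]
          obtain ⟨r1, r2, r3⟩ := ih (lmul c pc st.1 γu, st.2 ++ [st.1])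
            ⟨(lmul_bound c pc st.1 γu).1, fun x hx => ((lmul_bound c pc st.1 γu).2 x hx).trans (Nat.pow_lt_pow_right (by norm_num) (by omega))⟩ (fun r hr => by
            rw [List.mem_append, List.mem_singleton] at hr
            rcases hr with hr | rfl
            · exact h2 r hr
            · exact h1)
          exact ⟨r1, r2, by rw [r3, List.length_append, List.length_singleton, List.length_cons]; omega⟩
      have hlone : (lone pc.length).length ≤ pc.length ∧ ∀ x ∈ lone pc.length, x < 2 ^ (c.1 + 1) := by
        obtain ⟨h1, h2⟩ := lone_bound pc.length
        exact ⟨h1.le, fun x hx => (h2 x hx).trans_lt (by rw [pow_succ]; have := Nat.one_le_two_pow (n := c.1); omega)⟩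
      obtain ⟨s1, s2, s3⟩ := hshape l₁ (lone pc.length, []) hlone (fun r hr => absurd hr List.not_mem_nil)
      have hitem : ∀ r : List ℕ, (r.length ≤ pc.length ∧ ∀ x ∈ r, x < 2 ^ (c.1 + 1)) → (rawE natE r).length ≤ N * N + N := fun r ⟨h1, h2⟩ =>
        calc _ ≤ pc.length * (2 * (c.1 + 1) + 2) := length_rawE_natE_le_of_lt' h1 h2
          _ ≤ N * N + N := by nlinarith
      simp only [eval_add, eval_mul, eval_X, eval_ofNat]
      show (boolPair (rawE natE _) (rawE (rawE natE) _)).length ≤ _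
      rw [length_boolPair]
      have hA := hitem _ s1
      have hB : (rawE (rawE natE) (l₁.foldl (fun st _ => (lmul c pc st.1 γu, st.2 ++ [st.1])) (lone pc.length, [])).2).length ≤ N * (2 * (N * N + N) + 2) := by
        refine (length_rawE_le_of_forall fun r hr => hitem r (s2 r hr)).trans (Nat.mul_le_mul_right _ ?_)
        rw [s3, List.length_nil, zero_add]; exact hl
      nlinarith)
  have hm := (snd _ _).comp (h.comp ((CodeFP.id _).pair (replicateUnit.comp (snd _ _).snd'.snd')))
  exact hm.congr fun _ => rfl

/-- Code of `(c, pc, 1^{logq}, Hl, posL, xs, βu, αu, yu, 1ᵐ)`. [folklore] -/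
abbrev syE : (ℕ × ℕ × ℕ) × List ℕ × ℕ × List ℕ × List (List ℕ) × List Bool × List ℕ × List ℕ × List ℕ × ℕ → List Bool :=
  pairE kctxE (pairE (rawE natE) (pairE unE (pairE (rawE natE) (pairE (rawE (rawE natE)) (pairE strE (pairE (rawE natE) (pairE (rawE natE) (pairE (rawE natE) unE))))))))

/-- **`symbolsL` on codes.** [cite: Umans2003, §5, Thm. 14, eq. (7)] -/
theorem symbolsLC : CodeFP syE (rawE (rawE natE))
    (fun t => symbolsL t.1 t.2.1 t.2.2.1 t.2.2.2.1 t.2.2.2.2.1 t.2.2.2.2.2.1 t.2.2.2.2.2.2.1 t.2.2.2.2.2.2.2.1 t.2.2.2.2.2.2.2.2.1 t.2.2.2.2.2.2.2.2.2) := by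
  let stE : List ℕ × List (List ℕ) → List Bool := pairE (rawE natE) (rawE (rawE natE))
  let E := pairE syE (pairE unitE stE)
  have hc : CodeFP E kctxE (fun u => u.1.1) := (fst _ _).fst'
  have hpc : CodeFP E (rawE natE) (fun u => u.1.2.1) := (fst _ _).snd'.fst'
  have hlogq : CodeFP E unE (fun u => u.1.2.2.1) := (fst _ _).snd'.snd'.fst'
  have hHl : CodeFP E (rawE natE) (fun u => u.1.2.2.2.1) := (fst _ _).snd'.snd'.snd'.fst'
  have hposL : CodeFP E (rawE (rawE natE)) (fun u => u.1.2.2.2.2.1) := (fst _ _).snd'.snd'.snd'.snd'.fst'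
  have hxs : CodeFP E strE (fun u => u.1.2.2.2.2.2.1) := (fst _ _).snd'.snd'.snd'.snd'.snd'.fst'
  have hβ : CodeFP E (rawE natE) (fun u => u.1.2.2.2.2.2.2.1) := (fst _ _).snd'.snd'.snd'.snd'.snd'.snd'.fst'
  have hα : CodeFP E (rawE natE) (fun u => u.1.2.2.2.2.2.2.2.1) := (fst _ _).snd'.snd'.snd'.snd'.snd'.snd'.snd'.fst'
  have hst : CodeFP E (rawE natE) (fun u => u.2.2.1) := (snd _ _).snd'.fst'
  have hsy : CodeFP E (rawE (rawE natE)) (fun u => u.2.2.2) := (snd _ _).snd'.snd'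
  have hw : CodeFP E (rawE natE) (fun u => lmul u.1.1 u.1.2.1 u.1.2.2.2.2.2.2.2.1 u.2.2.1) := (lmulFP.comp (hc.pair (hpc.pair (hα.pair hst))) :)
  have haug := augEvalLC.comp (hc.pair (hpc.pair (hlogq.pair (hHl.pair (hposL.pair (hxs.pair (hβ.pair hw)))))))
  have hstep := hw.pair ((rawAppend (rawE natE)).comp (hsy.pair ((rawSingleton (rawE natE)).comp haug)))
  have hinit : CodeFP syE stE (fun s => (s.2.2.2.2.2.2.2.2.1, ([] : List (List ℕ)))) := (snd _ _).snd'.snd'.snd'.snd'.snd'.snd'.snd'.fst'.pair (const _ _)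
  have h := foldl (eσ := syE) (eα := unitE) (eβ := stE)
    (step := fun (s : (ℕ × ℕ × ℕ) × List ℕ × ℕ × List ℕ × List (List ℕ) × List Bool × List ℕ × List ℕ × List ℕ × ℕ) (_ : Unit) (st : List ℕ × List (List ℕ)) =>
      (lmul s.1 s.2.1 s.2.2.2.2.2.2.2.1 st.1, st.2 ++ [augEvalL s.1 s.2.1 s.2.2.1 s.2.2.2.1 s.2.2.2.2.1 s.2.2.2.2.2.1 s.2.2.2.2.2.2.1 (lmul s.1 s.2.1 s.2.2.2.2.2.2.2.1 st.1)]))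
    (init := fun s => (s.2.2.2.2.2.2.2.2.1, ([] : List (List ℕ)))) (hstep.congr fun _ => rfl) hinit ((X * X + X) * (X + 3) * 3)
    (fun s l₁ l₂ => by
      obtain ⟨c, pc, logq, Hl, posL, xs, βu, αu, yu, m⟩ := s
      set N := (pairE syE (rawE unitE) ((c, pc, logq, Hl, posL, xs, βu, αu, yu, m), l₁ ++ l₂)).length
      have hN0 : (syE (c, pc, logq, Hl, posL, xs, βu, αu, yu, m)).length ≤ N := (length_pairE_ge syE (rawE unitE) _ _).1
      have hW : 2 * c.1 + 4 ≤ N := by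
        obtain ⟨W, f, P⟩ := c
        refine le_trans ?_ hN0; simp only [pairE_apply, length_boolPair, length_unE]; omega
      have hR : pc.length ≤ N := by
        refine le_trans ((length_le_length_rawE natE pc).trans ?_) hN0; simp only [pairE_apply, length_boolPair]; omega
      have hY : (rawE natE yu).length ≤ N := by
        refine le_trans ?_ hN0; simp only [pairE_apply, length_boolPair]; omega
      have hl : l₁.length ≤ N := by
        have := length_le_length_rawE unitE (l₁ ++ l₂)
        have h2 := (length_pairE_ge syE (rawE unitE) (c, pc, logq, Hl, posL, xs, βu, αu, yu, m) (l₁ ++ l₂)).2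
        rw [List.length_append] at this; omega
      have hshape : ∀ (l : List Unit) (st : List ℕ × List (List ℕ)),
          (st.1 = yu ∨ (st.1.length ≤ pc.length ∧ ∀ x ∈ st.1, x < 2 ^ c.1)) → (∀ r ∈ st.2, r.length ≤ pc.length ∧ ∀ x ∈ r, x < 2 ^ c.1) →
          let st' := l.foldl (fun st _ => (lmul c pc αu st.1, st.2 ++ [augEvalL c pc logq Hl posL xs βu (lmul c pc αu st.1)])) st
          (st'.1 = yu ∨ (st'.1.length ≤ pc.length ∧ ∀ x ∈ st'.1, x < 2 ^ c.1)) ∧ (∀ r ∈ st'.2, r.length ≤ pc.length ∧ ∀ x ∈ r, x < 2 ^ c.1) ∧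
            st'.2.length = st.2.length + l.length := by
        intro l
        induction l with
        | nil => intro st h1 h2; exact ⟨h1, h2, rfl⟩
        | cons _ l ih =>
          intro st _ h2
          rw [List.foldl_cons]
          obtain ⟨r1, r2, r3⟩ := ih (lmul c pc αu st.1, st.2 ++ [augEvalL c pc logq Hl posL xs βu (lmul c pc αu st.1)]) (Or.inr (lmul_bound c pc αu st.1))
            (fun r hr => by
              rw [List.mem_append, List.mem_singleton] at hr
              rcases hr with hr | rfl
              · exact h2 r hr
              · exact augEvalL_shape c pc logq Hl posL xs βu _)
          exact ⟨r1, r2, by rw [r3, List.length_append, List.length_singleton, List.length_cons]; omega⟩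
      obtain ⟨s1, s2, s3⟩ := hshape l₁ (yu, []) (Or.inl rfl) (fun r hr => absurd hr List.not_mem_nil)
      have hitem : ∀ r : List ℕ, (r = yu ∨ (r.length ≤ pc.length ∧ ∀ x ∈ r, x < 2 ^ c.1)) → (rawE natE r).length ≤ N * N + N := by
        rintro r (rfl | ⟨h1, h2⟩)
        · nlinarith
        · calc _ ≤ pc.length * (2 * c.1 + 2) := length_rawE_natE_le_of_lt' h1 h2
            _ ≤ N * N + N := by nlinarith
      simp only [eval_add, eval_mul, eval_X, eval_ofNat]
      show (boolPair (rawE natE _) (rawE (rawE natE) _)).length ≤ _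
      rw [length_boolPair]
      have hA := hitem _ s1
      have hB : (rawE (rawE natE) (l₁.foldl (fun st _ => (lmul c pc αu st.1, st.2 ++ [augEvalL c pc logq Hl posL xs βu (lmul c pc αu st.1)])) (yu, [])).2).length ≤
          N * (2 * (N * N + N) + 2) := by
        refine (length_rawE_le_of_forall fun r hr => hitem r (Or.inr (s2 r hr))).trans (Nat.mul_le_mul_right _ ?_)
        rw [s3, List.length_nil, zero_add]; exact hl
      nlinarith)
  have hmU : CodeFP syE unE (fun s => s.2.2.2.2.2.2.2.2.2) := (snd _ _).snd'.snd'.snd'.snd'.snd'.snd'.snd'.snd'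
  have hm := (snd _ _).comp (h.comp ((CodeFP.id _).pair (replicateUnit.comp hmU)))
  exact hm.congr fun _ => rfl

/-- **`genBitsL` on codes**: `(c, 1ᵇ, symbols, a, yv) ↦ genBitsL c b symbols a yv`. [cite: Umans2003, Lemma 13] -/
theorem genBitsLC : CodeFP (pairE kctxE (pairE unE (pairE (rawE (rawE natE)) (pairE natE natE)))) strE
    (fun t => genBitsL t.1 t.2.1 t.2.2.1 t.2.2.2.1 t.2.2.2.2) := by
  let E := pairE kctxE (pairE unE (pairE (rawE (rawE natE)) (pairE natE natE)))
  have hc : CodeFP (pairE E (rawE natE)) kctxE (fun u => u.1.1) := (fst _ _).fst'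
  have hb : CodeFP (pairE E (rawE natE)) unE (fun u => u.1.2.1) := (fst _ _).snd'.fst'
  have ha : CodeFP (pairE E (rawE natE)) natE (fun u => u.1.2.2.2.1) := (fst _ _).snd'.snd'.snd'.fst'
  have hyv : CodeFP (pairE E (rawE natE)) natE (fun u => u.1.2.2.2.2) := (fst _ _).snd'.snd'.snd'.snd'
  have hsy : CodeFP (pairE E (rawE natE)) (rawE natE) (fun u => u.2) := snd _ _
  have hk := kevalC.comp (hc.pair (hsy.pair ha))
  have hbit := hadBC.comp (hb.pair (hk.pair hyv))
  have hm := (map hbit).comp ((CodeFP.id _).pair (snd _ _).snd'.fst')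
  exact ((bitsToStr.comp hm)).congr fun _ => rfl

/-- **`parseL` on codes**: `(1ᵇ, 1ᵏ, w) ↦ parseL b k w`. [folklore] -/
theorem parseLC : CodeFP (pairE unE (pairE unE strE)) (rawE natE) (fun t => parseL t.1 t.2.1 t.2.2) := by
  have hch : CodeFP (pairE unE (pairE unE strE)) (rawE strE) (fun t => (List.range t.2.1).map fun i => (t.2.2.drop (i * t.1)).take t.1) :=
    strChunks.comp ((snd _ _).fst'.pair ((fst _ _).pair (snd _ _).snd'))
  exact ((map₀ strVal).comp hch).congr fun t => by simp [parseL, List.map_map, Function.comp_def]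

/-! ### Parameter programs -/

/-- `bᵏ` as a numeral with the exponent read from a numeral under a unary cap `B`: `(1ᴮ, b, k) ↦ b^{min k B}`. [folklore] -/
theorem natPowCap : CodeFP (pairE unE (pairE natE natE)) natE (fun t => t.2.1 ^ min t.2.2 t.1) :=
  natPow.comp ((snd _ _).fst'.pair (unOfNatMin.comp ((fst _ _).pair (snd _ _).snd')))

/-- `getD 0` of a `find?` over `range B` as `headD` of `toList`. [folklore] -/
theorem find?_getD_eq_headD {p : ℕ → Bool} (l : List ℕ) : ((l.find? p).toList.headD 0) = (l.find? p).getD 0 := by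
  cases l.find? p <;> rfl

/-- **`clog2L` on codes** (unary in, unary out). [folklore] -/
theorem clog2LC : CodeFP unE unE clog2L := by
  -- context `B = n + 1` (unary), items `k < B`; predicate `B - 1 ≤ 2^{min k B}`
  have hp : CodeFP (pairE unE natE) bitE (fun u => decide (u.1 - 1 ≤ 2 ^ min u.2 u.1)) :=
    natLe.comp ((natSub.comp ((natOfUn.comp (fst _ _)).pair (const _ 1))).pair (natPowCap.comp ((fst _ _).pair ((const _ 2).pair (snd _ _)))))
  have hfind := (rawFind? hp).comp ((CodeFP.id _).pair urange)
  have hget := (rawHeadD natE natE_zero).comp ((optToList natE).comp hfind)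
  have hun := unOfNatMin.comp ((CodeFP.id _).pair hget)
  refine (hun.comp unSucc).congr fun n => ?_
  show min (((List.range (n + 1)).find? fun k => decide (n + 1 - 1 ≤ 2 ^ min k (n + 1))).toList.headD 0) (n + 1) = clog2L n
  rw [find?_getD_eq_headD, List.find?_congr (p₂ := fun k => decide (n ≤ 2 ^ k)) (fun k hk => by
    have := List.mem_range.1 hk; simp only [Nat.add_sub_cancel, min_eq_left this.le]), ← clog2L]
  -- `clog2L n ≤ n`
  obtain ⟨-, hmin⟩ := clog2L_spec n
  exact min_eq_left ((hmin n Nat.lt_two_pow_self.le).trans (Nat.le_succ n))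

/-- **`dBaseL` on codes**: `(h, 1ⁿ) ↦ dBaseL h n` (unary out). [folklore] -/
theorem dBaseLC : CodeFP (pairE natE unE) unE (fun t => dBaseL t.1 t.2) := by
  -- context `σ = (h, B = n + 1)`, items `e < B`; predicate `B - 1 < h^{min e B}`
  let σE : ℕ × ℕ → List Bool := pairE natE unE
  have hp : CodeFP (pairE σE natE) bitE (fun u => decide (u.1.2 - 1 < u.1.1 ^ min u.2 u.1.2)) :=
    natLt.comp ((natSub.comp ((natOfUn.comp (fst _ _).snd').pair (const _ 1))).pair (natPowCap.comp ((fst _ _).snd'.pair ((fst _ _).fst'.pair (snd _ _)))))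
  have hfind := (rawFind? hp).comp ((CodeFP.id _).pair (urange.comp (snd _ _)))
  have hget := (rawHeadD natE natE_zero).comp ((optToList natE).comp hfind)
  have hun := unOfNatMin.comp ((snd _ _).pair hget)
  refine (hun.comp ((fst _ _).pair (unSucc.comp (snd _ _)))).congr fun t => ?_
  obtain ⟨h, n⟩ := t
  show min (((List.range (n + 1)).find? fun e => decide (n + 1 - 1 < h ^ min e (n + 1))).toList.headD 0) (n + 1) = dBaseL h n
  rw [find?_getD_eq_headD, List.find?_congr (p₂ := fun e => decide (n < h ^ e)) (fun e he => by
    have := List.mem_range.1 he; simp only [Nat.add_sub_cancel, min_eq_left this.le]), ← dBaseL]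
  -- `dBaseL h n ≤ n`: the result of a `find?` over `range (n+1)` (or `0`)
  refine min_eq_left ?_
  rw [dBaseL]
  cases hf : (List.range (n + 1)).find? (fun e => decide (n < h ^ e)) with
  | none => exact Nat.zero_le _
  | some e => have := List.mem_range.1 (List.mem_of_find?_eq_some hf); rw [Option.getD_some]; omega

/-- **`nextPrimeL` on codes** (unary in, unary out). [folklore] -/
theorem nextPrimeLC : CodeFP unE unE nextPrimeL := by
  -- context `σ = (B = 2 D₀ + 3, D₀)` unary; the primality test with the inner range capped by `B`
  let σE : ℕ × ℕ → List Bool := pairE unE unE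
  -- inner predicate on `(((B, D₀), p), k)`: `k < 2 ∨ p % k ≠ 0`
  have hk : CodeFP (pairE (pairE σE natE) natE) bitE (fun v => decide (v.2 < 2) || !(decide (v.1.2 % v.2 = 0))) :=
    (natLt.comp ((snd _ _).pair (const _ 2))).or (natEq.comp ((natMod.comp ((fst _ _).snd'.pair (snd _ _))).pair (const _ 0))).not
  have hall : CodeFP (pairE σE natE) bitE (fun u => (List.range (min u.2 u.1.1)).all fun k => decide (k < 2) || !(decide (u.2 % k = 0))) :=
    ((all hk).comp ((CodeFP.id _).pair (rangeOf.comp ((fst _ _).fst'.pair (snd _ _))))).congr fun _ => rfl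
  have hprime : CodeFP (pairE σE natE) bitE (fun u => decide (2 ≤ u.2) && (List.range (min u.2 u.1.1)).all fun k => decide (k < 2) || !(decide (u.2 % k = 0))) :=
    (natLe.comp ((const _ 2).pair (snd _ _))).and hall
  have hpred : CodeFP (pairE σE natE) bitE (fun u => decide (u.1.2 ≤ u.2) && (decide (2 ≤ u.2) && (List.range (min u.2 u.1.1)).all fun k => decide (k < 2) || !(decide (u.2 % k = 0)))) :=
    (unLeNat.comp ((fst _ _).snd'.pair (snd _ _))).and hprime
  have hfl := (filter hpred).comp ((CodeFP.id _).pair (urange.comp (fst _ _)))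
  have hhd := (rawHeadD natE natE_zero).comp hfl
  have hB : CodeFP unE unE (fun D₀ => 2 * D₀ + 3) := (unAdd.comp ((unMulConst 2).pair (const _ 3)))
  have hun := unOfNatMin.comp ((hB).pair (hhd.comp (hB.pair (CodeFP.id _))))
  refine hun.congr fun D₀ => ?_
  show min (((List.range (2 * D₀ + 3)).filter fun p => decide (D₀ ≤ p) && (decide (2 ≤ p) &&
    (List.range (min p (2 * D₀ + 3))).all fun k => decide (k < 2) || !(decide (p % k = 0)))).headD 0) (2 * D₀ + 3) = nextPrimeL D₀
  have hfc : ((List.range (2 * D₀ + 3)).filter fun p => decide (D₀ ≤ p) && (decide (2 ≤ p) &&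
      (List.range (min p (2 * D₀ + 3))).all fun k => decide (k < 2) || !(decide (p % k = 0)))) =
      (List.range (2 * D₀ + 3)).filter fun p => decide (D₀ ≤ p) && isPrimeB p := by
    apply List.filter_congr
    intro p hp
    have := List.mem_range.1 hp
    rw [min_eq_left this.le, isPrimeB]
  rw [hfc, ← nextPrimeL]
  exact min_eq_left (by have := (nextPrimeL_spec D₀).2.2; omega)

/-- **`aOf` on codes.** [cite: Umans2003, §5] -/
theorem aOfC : CodeFP unE unE aOf := (clog2LC.comp (unSucc.comp unSucc)).congr fun _ => rfl

/-- **`MOf c0` on codes.** [cite: Umans2003, §5] -/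
theorem MOfC (c0 : ℕ) : CodeFP unE unE (MOf c0) := (unPred.comp ((unMulConst c0).comp aOfC)).congr fun m => by
  show c0 * aOf m - 1 = MOf c0 m; rw [MOf, mul_comm]

/-- The unary maximum. [folklore] -/
theorem unMax : CodeFP (pairE unE unE) unE (fun p => max p.1 p.2) :=
  ((unLeNat.comp ((fst _ _).pair (natOfUn.comp (snd _ _)))).ite (snd _ _) (fst _ _)).congr fun p => by
    obtain ⟨a, b⟩ := p
    dsimp only [id]
    by_cases h : a ≤ b
    · simp [h]
    · simp [h, max_eq_left (not_le.1 h).le]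

/-- **`dOf c0` on codes**: `(1ⁿ, 1ᵐ) ↦ dOf c0 n m`. [cite: Umans2003, §5, Lemma 7] -/
theorem dOfC (c0 : ℕ) : CodeFP (pairE unE unE) unE (fun t => dOf c0 t.1 t.2) := by
  have hh : CodeFP (pairE unE unE) natE (fun t => 2 ^ aOf t.2) := natPow.comp ((const _ 2).pair (aOfC.comp (snd _ _)))
  have hdb := dBaseLC.comp (hh.pair (fst _ _))
  have hmx := unMax.comp ((const _ (c0 + 1)).pair hdb)
  exact (nextPrimeLC.comp hmx).congr fun _ => rfl

/-! ### The field data and the generator -/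

/-- Code of `(1^{cap}, 1ᵃ, 1ᴹ, 1ᵈ)`. [folklore] -/
abbrev prmE : ℕ × ℕ × ℕ × ℕ → List Bool := pairE unE (pairE unE (pairE unE unE))

/-- `qOf M` as a numeral from unary `M`. [cite: Umans2003, §5] -/
theorem qOfC : CodeFP unE natE qOf := (natPow.comp ((const _ 2).pair unSucc)).congr fun _ => rfl

/-- `min (qOf M) cap` in unary, from `(cap, M)` unary. [folklore] -/
theorem qcC : CodeFP (pairE unE unE) unE (fun t => min (qOf t.2) t.1) := unOfNatMin.comp ((fst _ _).pair (qOfC.comp (snd _ _)))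

/-- **`ctxOf` on codes**: `(1^{cap}, 1ᴹ) ↦ ctxOf cap M`. [cite: Umans2003, §3] -/
theorem ctxOfC : CodeFP (pairE unE unE) kctxE (fun t => ctxOf t.1 t.2) :=
  ((unSucc.comp (unSucc.comp (snd _ _))).pair ((irredSearchFP.comp ((snd _ _).pair qcC)).pair (qOfC.comp (snd _ _)))).congr fun _ => rfl

/-- Projections of `prmE`. [folklore] -/
theorem prm_cap : CodeFP prmE unE (fun t => t.1) := fst _ _
/-- Projections of `prmE`. [folklore] -/
theorem prm_a : CodeFP prmE unE (fun t => t.2.1) := (snd _ _).fst'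
/-- Projections of `prmE`. [folklore] -/
theorem prm_M : CodeFP prmE unE (fun t => t.2.2.1) := (snd _ _).snd'.fst'
/-- Projections of `prmE`. [folklore] -/
theorem prm_d : CodeFP prmE unE (fun t => t.2.2.2) := (snd _ _).snd'.snd'
/-- The context from `prmE`. [folklore] -/
theorem prm_ctx : CodeFP prmE kctxE (fun t => ctxOf t.1 t.2.2.1) := ctxOfC.comp (prm_cap.pair prm_M)
/-- `min q cap` from `prmE`. [folklore] -/
theorem prm_qc : CodeFP prmE unE (fun t => min (qOf t.2.2.1) t.1) := qcC.comp (prm_cap.pair prm_M)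

/-- **`HlOf` on codes**: `(1^{cap}, 1ᵃ, 1ᴹ, 1ᵈ) ↦ HlOf cap a M`. [cite: Umans2003, §3] -/
theorem HlOfC : CodeFP prmE (rawE natE) (fun t => HlOf t.1 t.2.1 t.2.2.1) := by
  have hh : CodeFP prmE unE (fun t => min (2 ^ t.2.1) t.1) := unOfNatMin.comp (prm_cap.pair (natPow.comp ((const _ 2).pair prm_a)))
  have hp : CodeFP (pairE prmE natE) bitE (fun u => cpow (ctxOf u.1.1 u.1.2.2.1) u.2 (min (2 ^ u.1.2.1) u.1.1) == u.2) := by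
    have hpow : CodeFP (pairE prmE natE) natE (fun u => cpow (ctxOf u.1.1 u.1.2.2.1) u.2 (min (2 ^ u.1.2.1) u.1.1)) :=
      (kpowFP.comp ((prm_ctx.comp (fst _ _)).pair ((snd _ _).pair (hh.comp (fst _ _))))).congr fun _ => rfl
    exact ((beq natE_injective).comp (hpow.pair (snd _ _)))
  exact ((filter hp).comp ((CodeFP.id _).pair (urange.comp prm_qc))).congr fun _ => rfl

/-- **`pcOf` on codes.** [cite: Umans2003, §3, Lemma 7] -/
theorem pcOfC : CodeFP prmE (rawE natE) (fun t => pcOf t.1 t.2.1 t.2.2.1 t.2.2.2) :=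
  (findIrredLC.comp (prm_ctx.pair (prm_cap.pair (prm_qc.pair (prm_d.pair HlOfC))))).congr fun _ => rfl

/-- `q^d - 1` as a numeral from `prmE`. [folklore] -/
theorem prm_P : CodeFP prmE natE (fun t => qOf t.2.2.1 ^ t.2.2.2 - 1) := natSub.comp ((natPow.comp ((qOfC.comp prm_M).pair prm_d)).pair (const _ 1))

/-- **`αOf` on codes.** [cite: Umans2003, §4.1] -/
theorem αOfC : CodeFP prmE (rawE natE) (fun t => αOf t.1 t.2.1 t.2.2.1 t.2.2.2) :=
  (findPrimLC.comp (prm_ctx.pair (prm_cap.pair (prm_qc.pair (pcOfC.pair (unOfNatMin.comp (prm_cap.pair prm_P))))))).congr fun _ => rfl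

/-- **`βOf` on codes.** [cite: Umans2003, §4.2, Def. 9] -/
theorem βOfC : CodeFP prmE (rawE natE) (fun t => βOf t.1 t.2.1 t.2.2.1 t.2.2.2) :=
  (findNormalLC.comp (prm_ctx.pair (prm_cap.pair (prm_qc.pair (pcOfC.pair (unSucc.comp prm_M)))))).congr fun _ => rfl

/-- **`γOf` on codes.** [cite: Umans2003, §4.1] -/
theorem γOfC : CodeFP prmE (rawE natE) (fun t => γOf t.1 t.2.1 t.2.2.1 t.2.2.2) := by
  have hr : CodeFP prmE natE (fun t => (qOf t.2.2.1 ^ t.2.2.2 - 1) / ((2 ^ t.2.1) ^ t.2.2.2 - 1)) :=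
    natDiv.comp (prm_P.pair (natSub.comp ((natPow.comp ((natPow.comp ((const _ 2).pair prm_a)).pair prm_d)).pair (const _ 1))))
  have hB : CodeFP prmE unE (fun t => t.2.2.2 * (t.2.2.1 + 1) + 1) := unSucc.comp (unMulUn.comp (prm_d.pair (unSucc.comp prm_M)))
  exact (lpowBFP.comp (prm_ctx.pair (pcOfC.pair (αOfC.pair (hr.pair hB))))).congr fun _ => rfl

/-- Code of `(1^{cap}, xs, 1ᵐ, seed, 1ᵃ, 1ᴹ, 1ᵈ)`. [folklore] -/
abbrev gcE : ℕ × List Bool × ℕ × List Bool × ℕ × ℕ × ℕ → List Bool := pairE unE (pairE strE (pairE unE (pairE strE (pairE unE (pairE unE unE)))))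

/-- **`genCoreL` on codes.** [cite: Umans2003, Thm. 14, eq. (7); Thm. 6] -/
theorem genCoreLC : CodeFP gcE strE (fun t => genCoreL t.1 t.2.1 t.2.2.1 t.2.2.2.1 t.2.2.2.2.1 t.2.2.2.2.2.1 t.2.2.2.2.2.2) := by
  have hcap : CodeFP gcE unE (fun t => t.1) := fst _ _
  have hxs : CodeFP gcE strE (fun t => t.2.1) := (snd _ _).fst'
  have hm : CodeFP gcE unE (fun t => t.2.2.1) := (snd _ _).snd'.fst'
  have hseed : CodeFP gcE strE (fun t => t.2.2.2.1) := (snd _ _).snd'.snd'.fst'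
  have ha : CodeFP gcE unE (fun t => t.2.2.2.2.1) := (snd _ _).snd'.snd'.snd'.fst'
  have hM : CodeFP gcE unE (fun t => t.2.2.2.2.2.1) := (snd _ _).snd'.snd'.snd'.snd'.fst'
  have hd : CodeFP gcE unE (fun t => t.2.2.2.2.2.2) := (snd _ _).snd'.snd'.snd'.snd'.snd'
  have hprm : CodeFP gcE prmE (fun t => (t.1, t.2.2.2.2.1, t.2.2.2.2.2.1, t.2.2.2.2.2.2)) := hcap.pair (ha.pair (hM.pair hd))
  have hc := prm_ctx.comp hprm
  have hpc := pcOfC.comp hprm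
  have hγ := γOfC.comp hprm
  have hα := αOfC.comp hprm
  have hβ := βOfC.comp hprm
  have hHl := HlOfC.comp hprm
  have hpos := positionsLC.comp (hc.pair (hpc.pair (hγ.pair (strLength.comp hxs))))
  have hM1 : CodeFP gcE unE (fun t => t.2.2.2.2.2.1 + 1) := unSucc.comp hM
  have hprs := parseLC.comp (hM1.pair ((unSucc.comp (unSucc.comp hd)).pair hseed))
  have hyu := (rawTakeUn natE).comp (hd.pair hprs)
  have hav := (rawGetD natE natE_zero).comp (hprs.pair (natOfUn.comp hd))
  have hyv := (rawGetD natE natE_zero).comp (hprs.pair (natOfUn.comp (unSucc.comp hd)))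
  have hsy := symbolsLC.comp (hc.pair (hpc.pair (hM1.pair (hHl.pair (hpos.pair (hxs.pair (hβ.pair (hα.pair (hyu.pair hm)))))))))
  have hg := genBitsLC.comp (hc.pair (hM1.pair (hsy.pair (hav.pair hyv))))
  refine hg.congr fun t => ?_
  obtain ⟨cap, xs, m, seed, a, M, d⟩ := t
  rfl

/-- `padTable` on codes. [cite: MurrayWilliams2018, §2] -/
theorem padTableC : CodeFP strE strE padTable := ⟨padTableFn, padTableFn_mem_FP, padTableFn_apply⟩

/-- **`genL c0` on codes**: `(1^{cap}, Y, 1ˢ, seed) ↦ genL c0 cap Y s seed`. [cite: Umans2003, Thm. 6] -/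
theorem genLC (c0 : ℕ) : CodeFP (pairE unE (pairE strE (pairE unE strE))) strE (fun t => genL c0 t.1 t.2.1 t.2.2.1 t.2.2.2) := by
  let E := pairE unE (pairE strE (pairE unE strE))
  have hcap : CodeFP E unE (fun t => t.1) := fst _ _
  have hY : CodeFP E strE (fun t => t.2.1) := (snd _ _).fst'
  have hs : CodeFP E unE (fun t => t.2.2.1) := (snd _ _).snd'.fst'
  have hseed : CodeFP E strE (fun t => t.2.2.2) := (snd _ _).snd'.snd'
  have hxs := padTableC.comp hY
  have hn := strLength.comp hxs
  have hcore := genCoreLC.comp (hcap.pair (hxs.pair (hs.pair (hseed.pair ((aOfC.comp hs).pair (((MOfC c0).comp hs).pair ((dOfC c0).comp (hn.pair hs))))))))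
  have hsmall : CodeFP E bitE (fun t => decide (t.2.2.1 ≤ t.2.2.2.length)) := unLeNat.comp (hs.pair (natOfUn.comp (strLength.comp hseed)))
  have htake : CodeFP E strE (fun t => t.2.2.2.take t.2.2.1) := strTake.comp (hs.pair hseed)
  exact (hsmall.ite htake hcore).congr fun t => by
    obtain ⟨cap, Y, s, seed⟩ := t
    show (if decide (s ≤ seed.length) then seed.take s else genCoreL cap (padTable Y) s seed (aOf s) (MOf c0 s) (dOf c0 (padTable Y).length s)) = genL c0 cap Y s seed
    rw [genL]
    by_cases h : s ≤ seed.length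
    · rw [if_pos h, decide_eq_true h]; rfl
    · rw [if_neg h, decide_eq_false h]; rfl

/-- **Umans' generator is polynomial time** (Murray–Williams' interface `(Y, 1ˢ, seed)`).
[cite: Umans2003, Thm. 6 ("`G` can be computed in `n^{O(1)}` time"); MurrayWilliams2018, Thm. 3.1] -/
theorem genTopC (c0 : ℕ) : CodeFP (pairE (pairE strE unE) strE) strE (fun t => genTop c0 t.1.1 t.1.2 t.2) := by
  let E := pairE (pairE strE unE) strE
  have hY : CodeFP E strE (fun t => t.1.1) := (fst _ _).fst'
  have hs : CodeFP E unE (fun t => t.1.2) := (fst _ _).snd'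
  have hseed : CodeFP E strE (fun t => t.2) := snd _ _
  have hN : CodeFP E unE (fun t => t.1.1.length + t.1.2 + t.2.length + 2) :=
    unAdd.comp ((unAdd.comp ((unAdd.comp ((strLength.comp hY).pair hs)).pair (strLength.comp hseed))).pair (const _ 2))
  have hcap : CodeFP E unE (fun t => (t.1.1.length + t.1.2 + t.2.length + 2) ^ capExp) := ((ulength unitE).comp ((unitsPow capExp).comp hN)).congr fun _ => by simp
  exact ((genLC c0).comp (hcap.pair (hY.pair (hs.pair hseed)))).congr fun _ => rfl

end UmansFP

end Literature.Computability.Complexity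

end
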